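import Literature.Computability.Complexity.PaulPippengerSzemerediTrotter1983ArithCheck
import Literature.Computability.Complexity.PaulPippengerSzemerediTrotter1983Interp
import Literature.Computability.Complexity.PaulPippengerSzemerediTrotter1983Padding
import HarnessLib

/-!
# The verifier's re-simulation check of one time block, in linear time (PPST 1983, §3)

Literature / complexity toolkit, a machine brick of the inline formalization of
Paul–Pippenger–Szemerédi–Trotter 1983 (`PaulPippengerSzemerediTrotter1983.lean`, fact
`PaulEtAl1983_NTIME_not_subset_DTIME`; roadmap Layer 4, the linear-time verifier). The check
`sim(u)` of `…Spec.lean` re-runs time block `u` of the flat program `P` from the claimed counter and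
the claimed contents above the cut, for `b` steps, and compares the outcome with the claims:
(a) start heights, (r) room, (b) end control, (c) end heights, (d) end contents, (e) extreme
heights, (f) coverage (`TM2Blocks.CondSim` of `…Claims.lean`). This file builds the counter program
doing so — around the interpreter `PPSTInterp.simLoop` of `…Interp.lean` and the arithmetic bank
of `…ArithCheck.lean` — and proves its semantics and its linear cost:

* registers `SR K = CR ⊕ (IReg K ⊕ SX K)`: the check/arithmetic banks of `…ArithCheck.lean`, the
  interpreter's bank, and an input bank `SX K` (claimed fragments and numeric fields per stack,
  the two counters, the block length, `Q (b + 1)`);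
* loading (`loadK`, `capPc`, `loadFuel`; `runs_load`: the interpreter's canonical start state
  `PPSTInterp.canon P ⟨pc, frag⟩ h₀ h₀ b` with `h₀ = |frag|`, and `|frag k|` in binary),
  simulating (`PPSTInterp.runs_simLoop`), unloading (`unloadK`: end heights and extreme heights
  in binary via `LinClock.binLoop`, end contents compared with `Com.eqChk`), and the numeric
  comparisons as `PPSTChk.leTest`s;
* **`runs_simChk`** — from clean banks, `simChk` consumes its inputs, returns to clean banks and
  sets `ok := ok ∧ simVal`, within a number of steps linear in the inputs plus `b (3|P| + 11)`;
  **`simVal_iff`** — `simVal` decides `SimProp`, the seven clauses of `CondSim` written on the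
  values of the inputs (the identification with `CondSim` of the claims read off a record is
  done where the records are, in the verifier's assembly).

No named fact is introduced (definitions with bodies and theorems only).

## References

* W. J. Paul, N. Pippenger, E. Szemerédi, W. T. Trotter, *On determinism versus non-determinism
  and related problems*, FOCS 1983, 429–438, §3 [PaulEtAl1983].
-/

namespace Literature.Computability.Complexity

open Function Com PPSTChk _root_.Computability

/-- **Inputs of the re-simulation check**: per stack the claimed start/end fragments and the
numeric fields of records `u` (`htu cutu mnu mxu lou hibu`) and `u + 1` (`ht1`), the computed
binary length of the start fragment (`lenf`); the counters of `u` and `u + 1` (unary), the block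
length (unary), `Q (b + 1)` (binary), two scratch registers. [folklore] -/
inductive SX (K : ℕ) : Type
  | fr (k : Fin K) | efr (k : Fin K) | htu (k : Fin K) | ht1 (k : Fin K) | cutu (k : Fin K)
  | mnu (k : Fin K) | mxu (k : Fin K) | lou (k : Fin K) | hibu (k : Fin K) | lenf (k : Fin K)
  | pcu | pc1 | ub | c1 | w1 | w2
  deriving DecidableEq, Fintype

/-- All registers of the re-simulation check. [folklore] -/
abbrev SR (K : ℕ) : Type := CR ⊕ (IReg K ⊕ SX K)

namespace PPSTSim

variable {K : ℕ}

/-- A check/arithmetic-bank register. [folklore] -/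
def cr (c : CR) : SR K := Sum.inl c
/-- An interpreter register. [folklore] -/
def ir (i : IReg K) : SR K := Sum.inr (Sum.inl i)
/-- An input register. [folklore] -/
def sx (z : SX K) : SR K := Sum.inr (Sum.inr z)

/-- The register file assembled from the three banks. [folklore] -/
def sst (C : Regs CR) (I : Regs (IReg K)) (X : Regs (SX K)) : Regs (SR K) :=
  Sum.elim C (Sum.elim I X)

section SstLemmas

variable (C : Regs CR) (I : Regs (IReg K)) (X : Regs (SX K)) (v : List Bool)

/-- `cr` is injective. [folklore] -/
@[simp] theorem cr_inj {a b : CR} : (cr a : SR K) = cr b ↔ a = b := by simp [cr]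
/-- `ir` is injective. [folklore] -/
@[simp] theorem ir_inj {a b : IReg K} : ir a = ir b ↔ a = b := by simp [ir]
/-- `sx` is injective. [folklore] -/
@[simp] theorem sx_inj {a b : SX K} : sx a = sx b ↔ a = b := by simp [sx]
/-- The banks are disjoint. [folklore] -/
@[simp] theorem cr_ne_ir (a : CR) (i : IReg K) : cr a ≠ ir i := by simp [cr, ir]
/-- The banks are disjoint. [folklore] -/
@[simp] theorem ir_ne_cr (a : CR) (i : IReg K) : ir i ≠ cr a := by simp [cr, ir]
/-- The banks are disjoint. [folklore] -/
@[simp] theorem cr_ne_sx (a : CR) (z : SX K) : cr a ≠ sx z := by simp [cr, sx]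
/-- The banks are disjoint. [folklore] -/
@[simp] theorem sx_ne_cr (a : CR) (z : SX K) : sx z ≠ cr a := by simp [cr, sx]
/-- The banks are disjoint. [folklore] -/
@[simp] theorem ir_ne_sx (i : IReg K) (z : SX K) : ir i ≠ sx z := by simp [ir, sx]
/-- The banks are disjoint. [folklore] -/
@[simp] theorem sx_ne_ir (i : IReg K) (z : SX K) : sx z ≠ ir i := by simp [ir, sx]

/-- Reading the check banks. [folklore] -/
@[simp] theorem sst_cr (a : CR) : sst C I X (cr a) = C a := rfl
/-- Reading the interpreter bank. [folklore] -/
@[simp] theorem sst_ir (i : IReg K) : sst C I X (ir i) = I i := rfl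
/-- Reading the input bank. [folklore] -/
@[simp] theorem sst_sx (z : SX K) : sst C I X (sx z) = X z := rfl

/-- Writing the check banks. [folklore] -/
@[simp] theorem update_sst_cr (a : CR) : update (sst C I X) (cr a) v = sst (update C a v) I X := by
  funext r
  rcases r with a' | i | z
  · by_cases h : a' = a
    · subst h
      show update (sst C I X) (cr a') v (cr a') = update C a' v a'
      rw [update_self, update_self]
    · have h1 : (Sum.inl a' : SR K) ≠ cr a := fun e => h (by simpa [cr] using e)
      rw [update_of_ne h1]
      show C a' = update C a v a'
      rw [update_of_ne h]
  · have h1 : (Sum.inr (Sum.inl i) : SR K) ≠ cr a := by simp [cr]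
    rw [update_of_ne h1]; rfl
  · have h1 : (Sum.inr (Sum.inr z) : SR K) ≠ cr a := by simp [cr]
    rw [update_of_ne h1]; rfl
/-- Writing the interpreter bank. [folklore] -/
@[simp] theorem update_sst_ir (i : IReg K) : update (sst C I X) (ir i) v = sst C (update I i v) X := by
  funext r
  rcases r with a | i' | z
  · have h1 : (Sum.inl a : SR K) ≠ ir i := by simp [ir]
    rw [update_of_ne h1]; rfl
  · by_cases h : i' = i
    · subst h
      show update (sst C I X) (ir i') v (ir i') = update I i' v i'
      rw [update_self, update_self]
    · have h1 : (Sum.inr (Sum.inl i') : SR K) ≠ ir i := fun e => h (by simpa [ir] using e)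
      rw [update_of_ne h1]
      show I i' = update I i v i'
      rw [update_of_ne h]
  · have h1 : (Sum.inr (Sum.inr z) : SR K) ≠ ir i := by simp [ir]
    rw [update_of_ne h1]; rfl
/-- Writing the input bank. [folklore] -/
@[simp] theorem update_sst_sx (z : SX K) : update (sst C I X) (sx z) v = sst C I (update X z v) := by
  funext r
  rcases r with a | i | z'
  · have h1 : (Sum.inl a : SR K) ≠ sx z := by simp [sx]
    rw [update_of_ne h1]; rfl
  · have h1 : (Sum.inr (Sum.inl i) : SR K) ≠ sx z := by simp [sx]
    rw [update_of_ne h1]; rfl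
  · by_cases h : z' = z
    · subst h
      show update (sst C I X) (sx z') v (sx z') = update X z' v z'
      rw [update_self, update_self]
    · have h1 : (Sum.inr (Sum.inr z') : SR K) ≠ sx z := fun e => h (by simpa [sx] using e)
      rw [update_of_ne h1]
      show X z' = update X z v z'
      rw [update_of_ne h]

end SstLemmas

/-! ### Embeddings -/

/-- A check-bank program, embedded. [folklore] -/
abbrev crP (c : Com CR) : Com (SR K) := c.map Sum.inl
/-- An interpreter program, embedded. [folklore] -/
abbrev irP (c : Com (IReg K)) : Com (SR K) := (c.map Sum.inl).map Sum.inr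

/-- Simulation of an embedded check-bank program. [folklore] -/
theorem runs_crP {c : Com CR} {C C' : Regs CR} {B : ℕ} (h : Runs c C C' B) (I : Regs (IReg K))
    (X : Regs (SX K)) : Runs (crP c) (sst C I X) (sst C' I X) B := by
  unfold sst; exact h.inl _

/-- Simulation of an embedded interpreter program. [folklore] -/
theorem runs_irP {c : Com (IReg K)} {I I' : Regs (IReg K)} {B : ℕ} (h : Runs c I I' B)
    (C : Regs CR) (X : Regs (SX K)) : Runs (irP c) (sst C I X) (sst C I' X) B := by
  unfold sst; exact (h.inl X).inr C

/-! ### Generic loops -/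

/-- **Count-pour**: pour `a` onto `b` (reversing it) while pushing one unit per symbol onto each
register of `cs`. [folklore] -/
def countPour (a b : SR K) (cs : List (SR K)) : Com (SR K) :=
  loop a (push b true ;; pushWord' cs) (push b false ;; pushWord' cs)
where
  /-- one unit on each register of the list -/
  pushWord' : List (SR K) → Com (SR K)
  | [] => skip
  | c :: cs => push c true ;; pushWord' cs

/-- The effect of `countPour.pushWord'`. [folklore] -/
def pushAll (R : Regs (SR K)) : List (SR K) → Regs (SR K)
  | [] => R
  | c :: cs => pushAll (update R c (true :: R c)) cs

/-- Simulation of `countPour.pushWord'`. [folklore] -/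
theorem runs_pushWord' : ∀ (cs : List (SR K)) (R : Regs (SR K)),
    Runs (countPour.pushWord' cs) R (pushAll R cs) cs.length
  | [], R => by simpa [countPour.pushWord', pushAll] using Runs.skip R
  | c :: cs, R => by
    have h1 := Runs.push c true R
    have h2 := runs_pushWord' cs (update R c (true :: R c))
    exact (h1.seq h2).of_eq rfl (by simp only [List.length_cons]; omega)

/-- `pushAll` on a register outside the list. [folklore] -/
theorem pushAll_of_not_mem : ∀ (cs : List (SR K)) (R : Regs (SR K)) (r : SR K), r ∉ cs →
    pushAll R cs r = R r
  | [], _, _, _ => rfl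
  | c :: cs, R, r, hr => by
    simp only [List.mem_cons, not_or] at hr
    rw [pushAll, pushAll_of_not_mem cs _ r hr.2, update_of_ne hr.1]

/-- `pushAll` on a register occurring once in the list. [folklore] -/
theorem pushAll_of_mem : ∀ (cs : List (SR K)) (R : Regs (SR K)) (r : SR K), cs.Nodup → r ∈ cs →
    pushAll R cs r = true :: R r
  | [], _, _, _, hr => by simp at hr
  | c :: cs, R, r, hnd, hr => by
    rw [List.nodup_cons] at hnd
    rw [pushAll]
    by_cases hrc : r = c
    · subst hrc
      rw [pushAll_of_not_mem cs _ r hnd.1, update_self]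
    · have hr' : r ∈ cs := by simpa [hrc] using hr
      rw [pushAll_of_mem cs _ r hnd.2 hr', update_of_ne hrc]

open scoped Classical in
/-- **Simulation of `countPour`**: `a` emptied, `reverse a` on top of `b`, `|a|` units pushed on
each counter (`a`, `b` not among the counters, counters distinct). [folklore] -/
theorem runs_countPour {a b : SR K} (hab : a ≠ b) {cs : List (SR K)} (hnd : cs.Nodup)
    (ha : a ∉ cs) (hb : b ∉ cs) :
    ∀ (w : List Bool) (R : Regs (SR K)), R a = w →
      Runs (countPour a b cs) R
        (fun r => if r = a then [] else if r = b then w.reverse ++ R b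
          else if r ∈ cs then ones w.length ++ R r else R r)
        ((3 + cs.length) * w.length + 1)
  | [], R, hRa => by
    refine (Runs.loop_nil _ _ hRa).of_eq ?_ (by simp)
    funext r
    by_cases hra : r = a
    · subst hra; simp [hRa]
    · by_cases hrb : r = b
      · subst hrb; simp [hra]
      · by_cases hrc : r ∈ cs
        · rw [if_neg hra, if_neg hrb, if_pos hrc]; simp [ones]
        · rw [if_neg hra, if_neg hrb, if_neg hrc]
  | d :: w, R, hRa => by
    -- one round
    set R₀ := update R a w with hR₀
    set R₁ := update R₀ b (d :: R₀ b) with hR₁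
    have hbody : Runs (push b d ;; countPour.pushWord' cs) R₀ (pushAll R₁ cs) (cs.length + 1) := by
      have h1 := Runs.push b d R₀
      have h2 := runs_pushWord' cs R₁
      exact (h1.seq h2).of_eq rfl (by omega)
    have hR₂a : pushAll R₁ cs a = w := by
      rw [pushAll_of_not_mem cs _ a ha, hR₁, update_of_ne hab, hR₀, update_self]
    have ih := runs_countPour hab hnd ha hb w (pushAll R₁ cs) hR₂a
    have hfin : (fun r => if r = a then [] else if r = b then w.reverse ++ pushAll R₁ cs b
        else if r ∈ cs then ones w.length ++ pushAll R₁ cs r else pushAll R₁ cs r) =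
        (fun r => if r = a then [] else if r = b then (d :: w).reverse ++ R b
          else if r ∈ cs then ones (d :: w).length ++ R r else R r) := by
      funext r
      by_cases hra : r = a
      · simp [hra]
      · by_cases hrb : r = b
        · subst hrb
          simp only [hra, if_false, if_true, List.reverse_cons, List.append_assoc,
            List.singleton_append]
          rw [pushAll_of_not_mem cs _ r hb, hR₁, update_self, hR₀, update_of_ne (Ne.symm hab)]
        · simp only [hra, hrb, if_false]
          by_cases hrc : r ∈ cs
          · simp only [hrc, if_true, List.length_cons]
            rw [pushAll_of_mem cs _ r hnd hrc, hR₁, update_of_ne hrb, hR₀, update_of_ne hra]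
            simp [ones, List.replicate_succ']
          · simp only [hrc, if_false]
            rw [pushAll_of_not_mem cs _ r hrc, hR₁, update_of_ne hrb, hR₀, update_of_ne hra]
    have hmul : (3 + cs.length) * (w.length + 1) = (3 + cs.length) * w.length + (3 + cs.length) :=
      Nat.mul_succ _ _
    cases d
    · refine (Runs.loop_false hRa hbody ih).of_eq hfin ?_
      simp only [List.length_cons]; omega
    · refine (Runs.loop_true hRa hbody ih).of_eq hfin ?_
      simp only [List.length_cons]; omega

/-- **Capped unary copy**: pop `a`, and for each symbol move one unit of fuel from `f` to `c`
while fuel lasts: `c` receives `min |a| |f|` units. [folklore] -/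
def capLoop (a f c : SR K) : Com (SR K) :=
  loop a (pop f (push c true) skip skip) (pop f (push c true) skip skip)

/-- Simulation of `capLoop` (fuel all-true). [folklore] -/
theorem runs_capLoop {a f c : SR K} (haf : a ≠ f) (hac : a ≠ c) (hfc : f ≠ c) :
    ∀ (w : List Bool) (n : ℕ) (R : Regs (SR K)), R a = w → R f = ones n →
      Runs (capLoop a f c) R
        (update (update (update R a []) f (ones (n - w.length))) c
          (ones (min w.length n) ++ R c))
        (5 * w.length + 1)
  | [], n, R, hRa, hRf => by
    refine (Runs.loop_nil _ _ hRa).of_eq ?_ (by simp)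
    funext r
    rcases eq_or_ne r c with rfl | hrc
    · simp
    · rw [update_of_ne hrc]
      rcases eq_or_ne r f with rfl | hrf
      · simp [hRf]
      · rw [update_of_ne hrf]
        rcases eq_or_ne r a with rfl | hra
        · simp [hRa]
        · rw [update_of_ne hra]
  | d :: w, n, R, hRa, hRf => by
    set R₀ := update R a w with hR₀
    -- the body
    have hbody : Runs (pop f (push c true) skip skip) R₀
        (update (update R₀ f (ones (n - 1))) c (ones (min 1 n) ++ R₀ c)) 3 := by
      cases n with
      | zero =>
        have hf0 : R₀ f = [] := by rw [hR₀, update_of_ne (Ne.symm haf), hRf]; rfl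
        refine (Runs.pop_nil (push c true) skip hf0 (Runs.skip _)).of_eq ?_ (by omega)
        funext r
        rcases eq_or_ne r c with rfl | hrc
        · simp
        · rw [update_of_ne hrc]
          rcases eq_or_ne r f with rfl | hrf
          · simp [hf0]
          · rw [update_of_ne hrf]
      | succ n =>
        have hf1 : R₀ f = true :: ones n := by
          rw [hR₀, update_of_ne (Ne.symm haf), hRf]; rfl
        refine (Runs.pop_true skip skip hf1 (Runs.push c true _)).of_eq ?_ (by omega)
        simp [update_of_ne (Ne.symm hfc)]
    have hRa' : (update (update R₀ f (ones (n - 1))) c (ones (min 1 n) ++ R₀ c)) a = w := by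
      rw [update_of_ne hac, update_of_ne haf, hR₀, update_self]
    have hRf' : (update (update R₀ f (ones (n - 1))) c (ones (min 1 n) ++ R₀ c)) f = ones (n - 1) := by
      rw [update_of_ne hfc, update_self]
    have ih := runs_capLoop haf hac hfc w (n - 1) _ hRa' hRf'
    have hfin : update (update (update (update (update R₀ f (ones (n - 1))) c
        (ones (min 1 n) ++ R₀ c)) a []) f (ones (n - 1 - w.length))) c
        (ones (min w.length (n - 1)) ++ (update (update R₀ f (ones (n - 1))) c
          (ones (min 1 n) ++ R₀ c)) c) =
        update (update (update R a []) f (ones (n - (d :: w).length))) c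
          (ones (min (d :: w).length n) ++ R c) := by
      funext r
      by_cases hrc : r = c
      · subst hrc
        simp only [update_self, hR₀, update_of_ne (Ne.symm hac), List.length_cons]
        rw [← List.append_assoc]
        congr 1
        simp only [ones, ← List.replicate_add]
        congr 1
        omega
      · rw [update_of_ne hrc, update_of_ne hrc]
        by_cases hrf : r = f
        · subst hrf
          simp only [update_self, List.length_cons]
          congr 1; omega
        · rw [update_of_ne hrf, update_of_ne hrf]
          by_cases hra : r = a
          · subst hra; simp
          · rw [update_of_ne hra, update_of_ne hra, update_of_ne hrc, update_of_ne hrf, hR₀,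
              update_of_ne hra]
    cases d
    · exact (Runs.loop_false hRa hbody ih).of_eq hfin (by simp; omega)
    · exact (Runs.loop_true hRa hbody ih).of_eq hfin (by simp; omega)

/-- `|units|` of a constant: push `n` units on `r`. [folklore] -/
def unitsN (r : SR K) : ℕ → Com (SR K)
  | 0 => skip
  | n + 1 => unitsN r n ;; push r true

/-- Simulation of `unitsN`. [folklore] -/
theorem runs_unitsN (r : SR K) : ∀ (n : ℕ) (R : Regs (SR K)),
    Runs (unitsN r n) R (update R r (ones n ++ R r)) n
  | 0, R => by simpa [unitsN] using Runs.skip R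
  | n + 1, R => by
    have h1 := runs_unitsN r n R
    have h2 := Runs.push r true (update R r (ones n ++ R r))
    refine (h1.seq h2).of_eq ?_ (by simp)
    simp [ones, List.replicate_succ]

/-- `|encodeNat n| = size n ≤ n`. [folklore] -/
theorem length_encodeNat_le (n : ℕ) : (encodeNat n).length ≤ n := by
  have h := length_norm (encodeNat n)
  rw [norm_encodeNat, bitsToNat_encodeNat] at h
  rw [h]
  exact Nat.size_le.2 n.lt_two_pow_self

/-! ### Loading the interpreter -/

/-- **Loading stack `k`**: the claimed start fragment goes onto the simulated register (via the
scratch `w1`, to keep its order), its length in unary onto `x`, `mn k`, `mx k`; then the length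
in binary onto `lenf k` (`LinClock.binLoop`). [folklore] -/
def loadK (k : Fin K) : Com (SR K) :=
  pour (sx (.fr k)) (sx .w1) ;;
    countPour (sx .w1) (ir (.r k)) [cr (ar .x), ir (.mn k), ir (.mx k)] ;;
    crP (arA LinClock.binLoop) ;; pour (cr (ar .t)) (sx (.lenf k))

open scoped Classical in
/-- **Simulation of `loadK`.** [folklore] -/
theorem runs_loadK (k : Fin K) (zv : List Bool) (M : Regs MOwn) (G : Regs KR) (I : Regs (IReg K))
    (X : Regs (SX K)) (hw1 : X .w1 = []) (hr : I (.r k) = []) (hmn : I (.mn k) = [])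
    (hmx : I (.mx k) = []) (hlen : X (.lenf k) = []) :
    Runs (loadK k) (sst (st (AReg.file [] [] zv [] [] [] [] []) M G) I X)
      (sst (st (AReg.file [] [] zv [] [] [] [] []) M G)
        (update (update (update I (.r k) (X (.fr k))) (.mn k) (ones (X (.fr k)).length)) (.mx k)
          (ones (X (.fr k)).length))
        (update (update X (.fr k) []) (.lenf k) (encodeNat (X (.fr k)).length)))
      (36 * (X (.fr k)).length + 4) := by
  set w := X (.fr k) with hw
  set n := w.length with hn
  -- pour
  have h1 := runs_pour (a := sx (.fr k)) (b := sx (K := K) .w1) (by simp)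
    (sst (st (AReg.file [] [] zv [] [] [] [] []) M G) I X)
  simp only [sst_sx, ← hw, hw1, List.append_nil, update_sst_sx] at h1
  set X₁ := update (update X (.fr k) []) .w1 w.reverse with hX₁
  -- count-pour
  have h2 := runs_countPour (a := sx (K := K) .w1) (b := ir (.r k))
    (cs := [cr (ar .x), ir (.mn k), ir (.mx k)]) (by simp)
    (by simp) (by simp) (by simp) w.reverse (sst (st (AReg.file [] [] zv [] [] [] [] []) M G) I X₁)
    (by simp [X₁])
  set I₂ := update (update (update I (.r k) w) (.mn k) (ones n)) (.mx k) (ones n) with hI₂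
  set X₂ := update X₁ .w1 [] with hX₂
  have e2 : (fun r : SR K => if r = sx SX.w1 then [] else if r = ir (IReg.r k) then
      w.reverse.reverse ++ sst (st (AReg.file [] [] zv [] [] [] [] []) M G) I X₁ (ir (IReg.r k))
      else if r ∈ [cr (ar AReg.x), ir (IReg.mn k), ir (IReg.mx k)] then
        ones w.reverse.length ++ sst (st (AReg.file [] [] zv [] [] [] [] []) M G) I X₁ r
      else sst (st (AReg.file [] [] zv [] [] [] [] []) M G) I X₁ r) =
      sst (st (AReg.file (ones n) [] zv [] [] [] [] []) M G) I₂ X₂ := by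
    funext r
    rcases r with c | i | z
    · rcases c with (a | m) | g
      · have e : (Sum.inl (Sum.inl (Sum.inl a)) : SR K) = cr (ar a) := rfl
        rw [e]
        by_cases ha : a = .x
        · subst ha; simp [hn]
        · have : ¬ (cr (ar a) : SR K) ∈ [cr (ar AReg.x), ir (IReg.mn k), ir (IReg.mx k)] := by
            simp [ha]
          rw [if_neg (by simp), if_neg (by simp), if_neg this]
          cases a <;> simp at ha <;> rfl
      · have e : (Sum.inl (Sum.inl (Sum.inr m)) : SR K) = cr (mo m) := rfl
        rw [e, if_neg (by simp), if_neg (by simp), if_neg (by simp [mo, ar])]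
        simp
      · have e : (Sum.inl (Sum.inr g) : SR K) = cr (kr g) := rfl
        rw [e, if_neg (by simp), if_neg (by simp), if_neg (by simp [kr, ar])]
        simp
    · have e : (Sum.inr (Sum.inl i) : SR K) = ir i := rfl
      rw [e, if_neg (by simp)]
      by_cases hi1 : i = .r k
      · subst hi1; simp [I₂, hr]
      · rw [if_neg (by simpa using hi1)]
        by_cases hi2 : i = .mn k
        · subst hi2; simp [I₂, hmn, hn]
        · by_cases hi3 : i = .mx k
          · subst hi3; simp [I₂, hmx, hn]
          · rw [if_neg (by simp [hi2, hi3])]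
            simp [I₂, update_of_ne hi1, update_of_ne hi2, update_of_ne hi3]
    · have e : (Sum.inr (Sum.inr z) : SR K) = sx z := rfl
      rw [e]
      by_cases hz : z = .w1
      · subst hz; simp [X₂]
      · rw [if_neg (by simpa using hz), if_neg (by simp), if_neg (by simp)]
        simp [X₂, update_of_ne hz]
  rw [e2] at h2
  -- binary length
  have h3 := runs_crP (runs_arA (LinClock.runs_binLoop n [] [] zv [] []) M G) I₂ X₂
  simp only [List.append_nil] at h3
  -- pour the digits
  have h4 := runs_pour (a := cr (ar .t)) (b := sx (.lenf k)) (by simp)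
    (sst (st (AReg.file [] [] zv [] (encodeNat n).reverse [] [] []) M G) I₂ X₂)
  have el : X₂ (.lenf k) = [] := by simp [X₂, X₁, hlen]
  simp only [sst_cr, st_ar, AReg.file_t, sst_sx, el, List.append_nil, List.reverse_reverse,
    update_sst_cr, update_st_ar, AReg.update_file_t, update_sst_sx, List.length_reverse] at h4
  have hl := length_encodeNat_le n
  refine (h1.seq (h2.seq (h3.seq h4))).of_eq ?_ ?_
  · simp only [X₂, X₁, I₂]
    congr 1
    funext z
    rcases eq_or_ne z (.lenf k) with rfl | hz2
    · simp
    · rw [update_of_ne hz2, update_of_ne hz2]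
      rcases eq_or_ne z .w1 with rfl | hz1
      · simp [hw1]
      · rw [update_of_ne hz1, update_of_ne hz1]
  · simp only [List.length_reverse, List.length_cons, List.length_nil]
    omega

/-- Loading a list of stacks. [folklore] -/
def loadList : List (Fin K) → Com (SR K)
  | [] => skip
  | k :: ks => loadK k ;; loadList ks

/-- The interpreter bank after loading the stacks of `ks`. [folklore] -/
def Iload (frag : Fin K → List Bool) (I : Regs (IReg K)) (ks : List (Fin K)) : Regs (IReg K)
  | .r k => if k ∈ ks then frag k else I (.r k)
  | .mn k => if k ∈ ks then ones (frag k).length else I (.mn k)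
  | .mx k => if k ∈ ks then ones (frag k).length else I (.mx k)
  | i => I i

/-- The input bank after loading the stacks of `ks`. [folklore] -/
def Xload (X : Regs (SX K)) (ks : List (Fin K)) : Regs (SX K)
  | .fr k => if k ∈ ks then [] else X (.fr k)
  | .lenf k => if k ∈ ks then encodeNat (X (.fr k)).length else X (.lenf k)
  | z => X z

/-- **Simulation of `loadList`.** [folklore] -/
theorem runs_loadList (zv : List Bool) (M : Regs MOwn) (G : Regs KR) :
    ∀ (ks : List (Fin K)), ks.Nodup → ∀ (I : Regs (IReg K)) (X : Regs (SX K)), X .w1 = [] →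
      (∀ k ∈ ks, I (.r k) = [] ∧ I (.mn k) = [] ∧ I (.mx k) = [] ∧ X (.lenf k) = []) →
      Runs (loadList ks) (sst (st (AReg.file [] [] zv [] [] [] [] []) M G) I X)
        (sst (st (AReg.file [] [] zv [] [] [] [] []) M G) (Iload (fun k => X (.fr k)) I ks)
          (Xload X ks))
        (36 * (ks.map fun k => (X (.fr k)).length).sum + 4 * ks.length)
  | [], _, I, X, _, _ => by
    refine (Runs.skip _).of_eq ?_ (by simp)
    congr 1
    · funext i; cases i <;> simp [Iload]
    · funext z; cases z <;> simp [Xload]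
  | k :: ks, hnd, I, X, hw1, hcl => by
    rw [List.nodup_cons] at hnd
    obtain ⟨hr, hmn, hmx, hlen⟩ := hcl k (by simp)
    have h1 := runs_loadK k zv M G I X hw1 hr hmn hmx hlen
    set I₁ := update (update (update I (.r k) (X (.fr k))) (.mn k) (ones (X (.fr k)).length))
      (.mx k) (ones (X (.fr k)).length) with hI₁
    set X₁ := update (update X (.fr k) []) (.lenf k) (encodeNat (X (.fr k)).length) with hX₁
    have h2 := runs_loadList zv M G ks hnd.2 I₁ X₁ (by simp [X₁, hw1]) (by
      intro k' hk'
      have hne : k' ≠ k := by rintro rfl; exact hnd.1 hk'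
      obtain ⟨h1', h2', h3', h4'⟩ := hcl k' (by simp [hk'])
      refine ⟨?_, ?_, ?_, ?_⟩ <;> simp [I₁, X₁, hne, h1', h2', h3', h4'])
    have efr : ∀ k', X₁ (.fr k') = if k' = k then [] else X (.fr k') := by
      intro k'; by_cases h : k' = k
      · subst h; simp [X₁]
      · simp [X₁, h]
    refine (h1.seq h2).of_eq ?_ ?_
    · congr 1
      · funext i
        cases i with
        | r k' =>
          by_cases h : k' = k
          · subst h; simp [Iload, I₁, hnd.1]
          · simp [Iload, I₁, h, efr]
        | mn k' =>
          by_cases h : k' = k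
          · subst h; simp [Iload, I₁, hnd.1]
          · simp [Iload, I₁, h, efr]
        | mx k' =>
          by_cases h : k' = k
          · subst h; simp [Iload, I₁, hnd.1]
          · simp [Iload, I₁, h, efr]
        | dn k' => simp [Iload, I₁]
        | up k' => simp [Iload, I₁]
        | pc => simp [Iload, I₁]
        | fuel => simp [Iload, I₁]
      · funext z
        cases z with
        | fr k' =>
          by_cases h : k' = k
          · subst h; simp [Xload, X₁, hnd.1]
          · simp [Xload, X₁, h]
        | lenf k' =>
          by_cases h : k' = k
          · subst h; simp [Xload, X₁, hnd.1]
          · simp [Xload, X₁, h]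
        | _ => simp [Xload, X₁]
    · have hsum : (ks.map fun k' => (X₁ (.fr k')).length).sum =
          (ks.map fun k' => (X (.fr k')).length).sum := by
        apply congrArg; apply List.map_congr_left
        intro k' hk'
        have hne : k' ≠ k := by rintro rfl; exact hnd.1 hk'
        rw [efr, if_neg hne]
      rw [hsum]
      simp only [List.map_cons, List.sum_cons, List.length_cons]
      omega

/-- **Loading the counter**, capped at `|P|`: `pc := 1^{min pc |P|}`. [folklore] -/
def loadPc (np : ℕ) : Com (SR K) :=
  unitsN (cr (ar .y)) np ;; capLoop (sx .pcu) (cr (ar .y)) (ir .pc) ;; clear (cr (ar .y))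

/-- Simulation of `loadPc`. [folklore] -/
theorem runs_loadPc (np : ℕ) (xv zv : List Bool) (M : Regs MOwn) (G : Regs KR) (I : Regs (IReg K))
    (X : Regs (SX K)) (hpc : I .pc = []) :
    Runs (loadPc np) (sst (st (AReg.file xv [] zv [] [] [] [] []) M G) I X)
      (sst (st (AReg.file xv [] zv [] [] [] [] []) M G) (update I .pc (ones (min (X .pcu).length np)))
        (update X .pcu []))
      (3 * np + 5 * (X SX.pcu).length + 3) := by
  have h1 := runs_unitsN (cr (ar .y) : SR K) np (sst (st (AReg.file xv [] zv [] [] [] [] []) M G) I X)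
  simp only [sst_cr, st_ar, AReg.file_y, List.append_nil, update_sst_cr, update_st_ar,
    AReg.update_file_y] at h1
  have h2 := runs_capLoop (a := sx (K := K) .pcu) (f := cr (ar .y)) (c := ir .pc) (by simp)
    (by simp) (by simp) (X .pcu) np (sst (st (AReg.file xv (ones np) zv [] [] [] [] []) M G) I X)
    rfl rfl
  simp only [sst_ir, hpc, List.append_nil, update_sst_sx, update_sst_cr, update_st_ar,
    AReg.update_file_y, update_sst_ir] at h2
  have h3 := runs_clear (cr (ar .y) : SR K)
    (sst (st (AReg.file xv (ones (np - (X .pcu).length)) zv [] [] [] [] []) M G)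
      (update I .pc (ones (min (X .pcu).length np))) (update X .pcu []))
  simp only [sst_cr, st_ar, AReg.file_y, update_sst_cr, update_st_ar, AReg.update_file_y] at h3
  refine (h1.seq (h2.seq h3)).of_eq rfl ?_
  simp only [ones, List.length_replicate]
  omega

/-- **Loading the fuel**: one unit per symbol of the unary block length. [folklore] -/
def loadFuel : Com (SR K) := loop (sx .ub) (push (ir .fuel) true) (push (ir .fuel) true)

/-- Simulation of `loadFuel`. [folklore] -/
theorem runs_loadFuel : ∀ (w : List Bool) (R : Regs (SR K)), R (sx .ub) = w →
    Runs loadFuel R (update (update R (sx .ub) []) (ir .fuel) (ones w.length ++ R (ir .fuel)))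
      (3 * w.length + 1)
  | [], R, h => by
    refine (Runs.loop_nil _ _ h).of_eq ?_ (by simp)
    funext r
    rcases eq_or_ne r (ir .fuel) with rfl | h1
    · simp
    · rw [update_of_ne h1]
      rcases eq_or_ne r (sx .ub) with rfl | h2
      · simp [h]
      · rw [update_of_ne h2]
  | d :: w, R, h => by
    have hbody : ∀ R' : Regs (SR K), Runs (push (ir .fuel) true) R'
        (update R' (ir .fuel) (true :: R' (ir .fuel))) 1 := fun R' => Runs.push _ _ _
    have ih := runs_loadFuel w (update (update R (sx .ub) w) (ir .fuel)
      (true :: (update R (sx .ub) w) (ir .fuel))) (by simp)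
    have hfin : update (update (update (update R (sx SX.ub) w) (ir IReg.fuel)
        (true :: update R (sx SX.ub) w (ir IReg.fuel))) (sx SX.ub) []) (ir IReg.fuel)
        (ones w.length ++ update (update R (sx SX.ub) w) (ir IReg.fuel)
          (true :: update R (sx SX.ub) w (ir IReg.fuel)) (ir IReg.fuel)) =
        update (update R (sx SX.ub) []) (ir IReg.fuel) (ones (d :: w).length ++ R (ir IReg.fuel)) := by
      funext r
      rcases eq_or_ne r (ir .fuel) with rfl | h1
      · simp [ones, List.replicate_succ']
      · rw [update_of_ne h1, update_of_ne h1]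
        rcases eq_or_ne r (sx .ub) with rfl | h2
        · simp
        · simp [update_of_ne h1, update_of_ne h2]
    cases d
    · exact (Runs.loop_false h (hbody _) ih).of_eq hfin (by simp; omega)
    · exact (Runs.loop_true h (hbody _) ih).of_eq hfin (by simp; omega)

/-! ### The numeric tests of one stack (check-bank level) -/

/-- **The room test** (r): `ok := ok ∧ (lo = 0 ∨ c1 ≤ pa)` — normalize `lo` and branch on its
emptiness. [folklore] -/
def rTest : Com CR :=
  cp .lo .x ;; arA normalize ;;
    pop (ar .x) (clear (ar .x) ;; leTest .pa .c1 true) (clear (ar .x) ;; leTest .pa .c1 true) skip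

/-- The outcome of the room test. [folklore] -/
def rVal (G : Regs KR) : Bool :=
  decide (bitsToNat (G .lo) = 0) || decide (bitsToNat (G .c1) ≤ bitsToNat (G .pa))

/-- Simulation of `rTest`. [folklore] -/
theorem runs_rTest (o : Bool) (zv : List Bool) (M : Regs MOwn) (G : Regs KR) (hok : G .ok = flag o) :
    Runs rTest (st (AReg.file [] [] zv [] [] [] [] []) M G)
      (st (AReg.file [] [] zv [] [] [] [] []) M (update G .ok (flag (o && rVal G))))
      (49 * (G KR.lo).length + 28 * ((G KR.pa).length + (G KR.c1).length) + 38) := by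
  have h1 := runs_cp .lo (a := .x) (by decide) (by decide) (AReg.file [] [] zv [] [] [] [] []) M G
    rfl rfl
  simp only [AReg.file_x, List.append_nil, AReg.update_file_x] at h1
  have h2 := runs_arA (runs_normalize (G .lo) [] zv [] [] []) M G
  have hnl : (norm (G .lo)).length ≤ (G .lo).length := length_norm_le _
  -- the branch
  have h3 : Runs (pop (ar .x) (clear (ar .x) ;; leTest .pa .c1 true) (clear (ar .x) ;; leTest .pa .c1 true)
      skip) (st (AReg.file (norm (G .lo)) [] zv [] [] [] [] []) M G)
      (st (AReg.file [] [] zv [] [] [] [] []) M (update G .ok (flag (o && rVal G))))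
      (2 * (G KR.lo).length + 28 * ((G KR.pa).length + (G KR.c1).length) + 29) := by
    have hbr : ∀ w : List Bool, Runs (clear (ar .x) ;; leTest .pa .c1 true)
        (st (AReg.file w [] zv [] [] [] [] []) M G)
        (st (AReg.file [] [] zv [] [] [] [] []) M
          (update G .ok (flag (o && decide (bitsToNat (G .c1) ≤ bitsToNat (G .pa))))))
        (2 * w.length + 1 + (28 * ((G KR.pa).length + (G KR.c1).length) + 25)) := by
      intro w
      have hc := runs_clear (ar .x) (st (AReg.file w [] zv [] [] [] [] []) M G)
      simp only [st_ar, AReg.file_x, update_st_ar, AReg.update_file_x] at hc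
      have ht := runs_leTest .pa .c1 true o zv M G hok
      exact (hc.seq ht).of_eq (by simp [leVal]) le_rfl
    rcases hn : norm (G .lo) with _ | ⟨d, w⟩
    · -- `lo = 0`
      have h0 : bitsToNat (G .lo) = 0 := by
        have := bitsToNat_norm (G .lo); rw [hn] at this; simpa using this.symm
      refine (Runs.pop_nil _ _ (by simp) (Runs.skip _)).of_eq ?_ (by omega)
      simp only [rVal, h0, decide_true, Bool.true_or, Bool.and_true]
      rw [← hok, update_eq_self]
    · -- `lo ≠ 0`
      have h0 : bitsToNat (G .lo) ≠ 0 := by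
        intro hz
        have := norm_eq_encodeNat (G .lo)
        rw [hz, hn] at this
        simp [encodeNat, encodeNum] at this
      have hw : w.length ≤ (G .lo).length := by rw [hn] at hnl; simp at hnl; omega
      have e : rVal G = decide (bitsToNat (G .c1) ≤ bitsToNat (G .pa)) := by simp [rVal, h0]
      rw [e]
      cases d
      · refine (Runs.pop_false' _ _ (w := w) (by simp) (by simp) (hbr w)).of_eq rfl (by omega)
      · refine (Runs.pop_true' _ _ (w := w) (by simp) (by simp) (hbr w)).of_eq rfl (by omega)
  exact (h1.seq (h2.seq h3)).of_eq rfl (by omega)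

/-- The inputs of the per-stack tests, all cleared at the end. [folklore] -/
def simRegs : List KR :=
  [.ht, .hi, .cut, .mn, .mx, .lo, .hib, .c1, .pa, .pb, .pc, .pd, .mnp, .mxp, .t]

/-- **The per-stack numeric tests**: (a) `pa + cut = ht`, (r), (c) `pb + cut = hi`,
(e) `pc + cut = mn`, `pd + cut = mx`, (f) `ht ≤ hib`; then clear the bank. [folklore] -/
def simTests : Com CR :=
  addTo .pa .cut .mnp ;; leTests [(.mnp, .ht, true), (.ht, .mnp, true)] ;; rTest ;;
    addTo .pb .cut .mxp ;; leTests [(.mxp, .hi, true), (.hi, .mxp, true)] ;;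
    addTo .pc .cut .t ;; leTests [(.t, .mn, true), (.mn, .t, true)] ;; clear (kr .t) ;;
    addTo .pd .cut .t ;; leTests [(.t, .mx, true), (.mx, .t, true), (.hib, .ht, true)] ;;
    clears simRegs

/-- The outcome of the per-stack tests, on values. [folklore] -/
def simKVal (G : Regs KR) : Bool :=
  decide (bitsToNat (G .pa) + bitsToNat (G .cut) = bitsToNat (G .ht)) && rVal G &&
    decide (bitsToNat (G .pb) + bitsToNat (G .cut) = bitsToNat (G .hi)) &&
    decide (bitsToNat (G .pc) + bitsToNat (G .cut) = bitsToNat (G .mn)) &&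
    decide (bitsToNat (G .pd) + bitsToNat (G .cut) = bitsToNat (G .mx)) &&
    decide (bitsToNat (G .ht) ≤ bitsToNat (G .hib))

/-- The total length of the inputs of the per-stack tests. [folklore] -/
def ksum (G : Regs KR) : ℕ :=
  (G .ht).length + (G .hi).length + (G .cut).length + (G .mn).length + (G .mx).length +
    (G .lo).length + (G .hib).length + (G .c1).length + (G .pa).length + (G .pb).length +
    (G .pc).length + (G .pd).length

/-- Antisymmetry as a Boolean identity. [folklore] -/
theorem decide_le_and_le (a b : ℕ) : (decide (a ≤ b) && decide (b ≤ a)) = decide (b = a) := by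
  by_cases h : b = a
  · subst h; simp
  · rcases Nat.lt_or_gt_of_ne h with h' | h'
    · simp [h, Nat.not_le.2 h']
    · simp [h, Nat.not_le.2 h']

/-- `rVal` only reads `lo`, `c1`, `pa`. [folklore] -/
theorem rVal_congr {G G' : Regs KR} (h1 : G' .lo = G .lo) (h2 : G' .c1 = G .c1) (h3 : G' .pa = G .pa) :
    rVal G' = rVal G := by simp [rVal, h1, h2, h3]

/-- **Simulation of the per-stack tests.** [folklore] -/
theorem runs_simTests (o : Bool) (zv : List Bool) (M : Regs MOwn) (G : Regs KR) (hok : G .ok = flag o)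
    (ht : G .t = []) (hmnp : G .mnp = []) (hmxp : G .mxp = []) :
    Runs simTests (st (AReg.file [] [] zv [] [] [] [] []) M G)
      (st (AReg.file [] [] zv [] [] [] [] []) M (update (cleared G simRegs) .ok (flag (o && simKVal G))))
      (400 * ksum G + 900) := by
  -- (a)
  have h1 := runs_addTo .pa .cut .mnp zv M G hmnp
  set S1 := addRes (G .pa) (G .cut) with hS1
  set G₁ := update G .mnp S1 with hG₁
  have h2 := runs_leTests zv M [(.mnp, .ht, true), (.ht, .mnp, true)]
    (by intro x hx; simp at hx; rcases hx with rfl | rfl <;> decide) G₁ o (by simp [G₁, hok])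
  set v1 := allVal G₁ [(.mnp, .ht, true), (.ht, .mnp, true)] with hv1
  set G₂ := update G₁ .ok (flag (o && v1)) with hG₂
  -- (r)
  have er : rVal G₂ = rVal G := rVal_congr (by simp [G₂, G₁]) (by simp [G₂, G₁]) (by simp [G₂, G₁])
  have h3 : Runs rTest (st (AReg.file [] [] zv [] [] [] [] []) M G₂)
      (st (AReg.file [] [] zv [] [] [] [] []) M (update G₂ .ok (flag ((o && v1) && rVal G))))
      (49 * (G KR.lo).length + 28 * ((G KR.pa).length + (G KR.c1).length) + 38) := by
    have h := runs_rTest (o && v1) zv M G₂ (by simp [G₂])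
    rw [er] at h
    refine h.of_eq rfl (le_of_eq ?_)
    simp [G₂, G₁]
  set G₃ := update G₂ .ok (flag (o && v1 && rVal G)) with hG₃
  -- (c)
  have h4 := runs_addTo .pb .cut .mxp zv M G₃ (by simp [G₃, G₂, G₁, hmxp])
  set S2 := addRes (G .pb) (G .cut) with hS2
  have e4a : G₃ .pb = G .pb := by simp [G₃, G₂, G₁]
  have e4b : G₃ .cut = G .cut := by simp [G₃, G₂, G₁]
  rw [e4a, e4b] at h4
  set G₄ := update G₃ .mxp S2 with hG₄
  have h5 := runs_leTests zv M [(.mxp, .hi, true), (.hi, .mxp, true)]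
    (by intro x hx; simp at hx; rcases hx with rfl | rfl <;> decide) G₄ (o && v1 && rVal G)
    (by simp [G₄, G₃])
  set v2 := allVal G₄ [(.mxp, .hi, true), (.hi, .mxp, true)] with hv2
  set G₅ := update G₄ .ok (flag ((o && v1 && rVal G) && v2)) with hG₅
  -- (e) min
  have h6 := runs_addTo .pc .cut .t zv M G₅ (by simp [G₅, G₄, G₃, G₂, G₁, ht])
  set S3 := addRes (G .pc) (G .cut) with hS3
  have e6a : G₅ .pc = G .pc := by simp [G₅, G₄, G₃, G₂, G₁]
  have e6b : G₅ .cut = G .cut := by simp [G₅, G₄, G₃, G₂, G₁]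
  rw [e6a, e6b] at h6
  set G₆ := update G₅ .t S3 with hG₆
  have h7 := runs_leTests zv M [(.t, .mn, true), (.mn, .t, true)]
    (by intro x hx; simp at hx; rcases hx with rfl | rfl <;> decide) G₆ ((o && v1 && rVal G) && v2)
    (by simp [G₆, G₅])
  set v3 := allVal G₆ [(.t, .mn, true), (.mn, .t, true)] with hv3
  set G₇ := update G₆ .ok (flag (((o && v1 && rVal G) && v2) && v3)) with hG₇
  have h8 := runs_clear (kr .t) (st (AReg.file [] [] zv [] [] [] [] []) M G₇)
  simp only [st_kr, update_st_kr] at h8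
  have e8 : G₇ .t = S3 := by simp [G₇, G₆]
  rw [e8] at h8
  set G₈ := update G₇ .t [] with hG₈
  -- (e) max
  have h9 := runs_addTo .pd .cut .t zv M G₈ (by simp [G₈])
  set S4 := addRes (G .pd) (G .cut) with hS4
  have e9a : G₈ .pd = G .pd := by simp [G₈, G₇, G₆, G₅, G₄, G₃, G₂, G₁]
  have e9b : G₈ .cut = G .cut := by simp [G₈, G₇, G₆, G₅, G₄, G₃, G₂, G₁]
  rw [e9a, e9b] at h9
  set G₉ := update G₈ .t S4 with hG₉
  have h10 := runs_leTests zv M [(.t, .mx, true), (.mx, .t, true), (.hib, .ht, true)]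
    (by intro x hx; simp at hx; rcases hx with rfl | rfl | rfl <;> decide) G₉
    (((o && v1 && rVal G) && v2) && v3) (by simp [G₉, G₈, G₇])
  set v4 := allVal G₉ [(.t, .mx, true), (.mx, .t, true), (.hib, .ht, true)] with hv4
  set G₁₀ := update G₉ .ok (flag ((((o && v1 && rVal G) && v2) && v3) && v4)) with hG₁₀
  -- clears
  have h11 := runs_clears (AReg.file [] [] zv [] [] [] [] []) M simRegs G₁₀
  -- lengths
  have l1 : S1.length ≤ (G .pa).length + (G .cut).length + 1 := length_addRes_le _ _
  have l2 : S2.length ≤ (G .pb).length + (G .cut).length + 1 := length_addRes_le _ _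
  have l3 : S3.length ≤ (G .pc).length + (G .cut).length + 1 := length_addRes_le _ _
  have l4 : S4.length ≤ (G .pd).length + (G .cut).length + 1 := length_addRes_le _ _
  -- values
  have eval : ((((o && v1 && rVal G) && v2) && v3) && v4) = (o && simKVal G) := by
    have a1 : v1 = decide (bitsToNat (G .pa) + bitsToNat (G .cut) = bitsToNat (G .ht)) := by
      simp only [hv1, allVal, leVal, cond_true, Bool.and_true]
      have : G₁ .mnp = S1 := by simp [G₁]
      rw [this, show G₁ .ht = G .ht by simp [G₁], hS1, bitsToNat_addRes, decide_le_and_le]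
    have a2 : v2 = decide (bitsToNat (G .pb) + bitsToNat (G .cut) = bitsToNat (G .hi)) := by
      simp only [hv2, allVal, leVal, cond_true, Bool.and_true]
      have : G₄ .mxp = S2 := by simp [G₄]
      rw [this, show G₄ .hi = G .hi by simp [G₄, G₃, G₂, G₁], hS2, bitsToNat_addRes,
        decide_le_and_le]
    have a3 : v3 = decide (bitsToNat (G .pc) + bitsToNat (G .cut) = bitsToNat (G .mn)) := by
      simp only [hv3, allVal, leVal, cond_true, Bool.and_true]
      have : G₆ .t = S3 := by simp [G₆]
      rw [this, show G₆ .mn = G .mn by simp [G₆, G₅, G₄, G₃, G₂, G₁], hS3, bitsToNat_addRes,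
        decide_le_and_le]
    have a4 : v4 = (decide (bitsToNat (G .pd) + bitsToNat (G .cut) = bitsToNat (G .mx)) &&
        decide (bitsToNat (G .ht) ≤ bitsToNat (G .hib))) := by
      simp only [hv4, allVal, leVal, cond_true, Bool.and_true]
      have : G₉ .t = S4 := by simp [G₉]
      rw [this, show G₉ .mx = G .mx by simp [G₉, G₈, G₇, G₆, G₅, G₄, G₃, G₂, G₁],
        show G₉ .hib = G .hib by simp [G₉, G₈, G₇, G₆, G₅, G₄, G₃, G₂, G₁],
        show G₉ .ht = G .ht by simp [G₉, G₈, G₇, G₆, G₅, G₄, G₃, G₂, G₁], hS4, bitsToNat_addRes,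
        ← Bool.and_assoc, decide_le_and_le]
    rw [a1, a2, a3, a4]
    simp only [simKVal, Bool.and_assoc]
  -- the final bank
  have efin : cleared G₁₀ simRegs = update (cleared G simRegs) .ok (flag (o && simKVal G)) := by
    funext k
    by_cases hk : k ∈ simRegs
    · rw [cleared_of_mem _ _ _ hk]
      have hko : k ≠ .ok := by rintro rfl; simp [simRegs] at hk
      rw [update_of_ne hko, cleared_of_mem _ _ _ hk]
    · rw [cleared_of_not_mem _ _ _ hk]
      by_cases hko : k = .ok
      · subst hko
        rw [update_self]
        simp only [G₁₀, update_self, eval]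
      · rw [update_of_ne hko, cleared_of_not_mem _ _ _ hk]
        simp only [simRegs, List.mem_cons, List.not_mem_nil, or_false, not_or] at hk
        obtain ⟨n1, n2, n3, n4, n5, n6, n7, n8, n9, n10, n11, n12, n13, n14, n15⟩ := hk
        simp [G₁₀, G₉, G₈, G₇, G₆, G₅, G₄, G₃, G₂, G₁, hko, n13, n14, n15]
  -- costs of the test lists and of the clears
  have c2 : testsCost G₁ [(.mnp, .ht, true), (.ht, .mnp, true)] ≤
      56 * ((G .pa).length + (G .cut).length + 1 + (G .ht).length) + 50 := by
    simp only [testsCost, G₁, update_self, ne_eq, reduceCtorEq, not_false_eq_true, update_of_ne]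
    omega
  have c5 : testsCost G₄ [(.mxp, .hi, true), (.hi, .mxp, true)] ≤
      56 * ((G .pb).length + (G .cut).length + 1 + (G .hi).length) + 50 := by
    have e1 : G₄ .mxp = S2 := by simp [G₄]
    have e2 : G₄ .hi = G .hi := by simp [G₄, G₃, G₂, G₁]
    simp only [testsCost, e1, e2]
    omega
  have c7 : testsCost G₆ [(.t, .mn, true), (.mn, .t, true)] ≤
      56 * ((G .pc).length + (G .cut).length + 1 + (G .mn).length) + 50 := by
    have e1 : G₆ .t = S3 := by simp [G₆]
    have e2 : G₆ .mn = G .mn := by simp [G₆, G₅, G₄, G₃, G₂, G₁]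
    simp only [testsCost, e1, e2]
    omega
  have c10 : testsCost G₉ [(.t, .mx, true), (.mx, .t, true), (.hib, .ht, true)] ≤
      56 * ((G .pd).length + (G .cut).length + 1 + (G .mx).length) +
        28 * ((G .hib).length + (G .ht).length) + 75 := by
    have e1 : G₉ .t = S4 := by simp [G₉]
    have e2 : G₉ .mx = G .mx := by simp [G₉, G₈, G₇, G₆, G₅, G₄, G₃, G₂, G₁]
    have e3 : G₉ .hib = G .hib := by simp [G₉, G₈, G₇, G₆, G₅, G₄, G₃, G₂, G₁]
    have e5 : G₉ .ht = G .ht := by simp [G₉, G₈, G₇, G₆, G₅, G₄, G₃, G₂, G₁]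
    simp only [testsCost, e1, e2, e3, e5]
    omega
  have c11 : clearsCost G₁₀ simRegs ≤ 2 * ksum G + 2 * (S1.length + S2.length + S4.length) + 15 := by
    have h0 := clearsCost_le simRegs G₁₀
    have e : (simRegs.map fun k => (G₁₀ k).length).sum =
        (G .ht).length + (G .hi).length + (G .cut).length + (G .mn).length + (G .mx).length +
        (G .lo).length + (G .hib).length + (G .c1).length + (G .pa).length + (G .pb).length +
        (G .pc).length + (G .pd).length + S1.length + S2.length + S4.length := by
      simp [simRegs, G₁₀, G₉, G₈, G₇, G₆, G₅, G₄, G₃, G₂, G₁]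
      ring
    have hl : simRegs.length = 15 := rfl
    rw [e, hl] at h0
    unfold ksum; omega
  refine (h1.seq (h2.seq (h3.seq (h4.seq (h5.seq (h6.seq (h7.seq (h8.seq (h9.seq (h10.seq
    h11)))))))))).of_eq (by rw [efin]) ?_
  unfold ksum at c11 ⊢
  omega

/-! ### Unloading the interpreter -/

/-- Binary length of `x` (holding `1ⁿ`) into check register `dst`: `binLoop`, then pour the
digits. [folklore] -/
def binTo (dst : KR) : Com (SR K) := crP (arA LinClock.binLoop) ;; pour (cr (ar .t)) (cr (kr dst))

/-- Simulation of `binTo`. [folklore] -/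
theorem runs_binTo (dst : KR) (n : ℕ) (zv : List Bool) (M : Regs MOwn) (G : Regs KR)
    (I : Regs (IReg K)) (X : Regs (SX K)) (hd : G dst = []) :
    Runs (binTo dst) (sst (st (AReg.file (ones n) [] zv [] [] [] [] []) M G) I X)
      (sst (st (AReg.file [] [] zv [] [] [] [] []) M (update G dst (encodeNat n))) I X)
      (27 * n + 2) := by
  have h1 := runs_crP (runs_arA (LinClock.runs_binLoop n [] [] zv [] []) M G) I X
  simp only [List.append_nil] at h1
  have h2 := runs_pour (a := cr (ar .t)) (b := cr (K := K) (kr dst)) (by simp)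
    (sst (st (AReg.file [] [] zv [] (encodeNat n).reverse [] [] []) M G) I X)
  simp only [sst_cr, st_ar, AReg.file_t, st_kr, hd, List.append_nil, List.reverse_reverse,
    update_sst_cr, update_st_ar, AReg.update_file_t, update_st_kr, List.length_reverse] at h2
  have hl := length_encodeNat_le n
  exact (h1.seq h2).of_eq rfl (by omega)

/-- **Unloading stack `k`**: the end height in binary onto `pb`, the end contents compared with
the claimed end fragment (into `ok`), the extreme heights in binary onto `pc`, `pd`, the two
difference counters discarded. [folklore] -/
def unloadK (k : Fin K) : Com (SR K) :=
  countPour (ir (.r k)) (sx .w1) [cr (ar .x)] ;; binTo .pb ;;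
    pour (sx (.efr k)) (sx .w2) ;; eqChk (sx .w1) (sx .w2) (cr (ar .g)) ;; crP tstN ;;
    pour (ir (.mn k)) (cr (ar .x)) ;; binTo .pc ;;
    pour (ir (.mx k)) (cr (ar .x)) ;; binTo .pd ;;
    clear (ir (.dn k)) ;; clear (ir (.up k))

open scoped Classical in
/-- **Simulation of `unloadK`.** [folklore] -/
theorem runs_unloadK (k : Fin K) (o : Bool) (zv : List Bool) (M : Regs MOwn) (G : Regs KR)
    (I : Regs (IReg K)) (X : Regs (SX K)) (smin smax : ℕ) (hok : G .ok = flag o)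
    (hpb : G .pb = []) (hpc : G .pc = []) (hpd : G .pd = []) (hmn : I (.mn k) = ones smin)
    (hmx : I (.mx k) = ones smax) (hw1 : X .w1 = []) (hw2 : X .w2 = []) :
    Runs (unloadK k) (sst (st (AReg.file [] [] zv [] [] [] [] []) M G) I X)
      (sst (st (AReg.file [] [] zv [] [] [] [] []) M
        (update (update (update (update G .pb (encodeNat (I (.r k)).length)) .ok
          (flag (o && decide (I (.r k) = X (.efr k))))) .pc (encodeNat smin)) .pd (encodeNat smax)))
        (update (update (update (update (update I (.r k) []) (.mn k) []) (.mx k) []) (.dn k) [])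
          (.up k) [])
        (update X (.efr k) []))
      (39 * (I (IReg.r k)).length + 9 * (X (SX.efr k)).length + 30 * (smin + smax) +
        2 * ((I (IReg.dn k)).length + (I (IReg.up k)).length) + 19) := by
  set R := I (.r k) with hR
  set E := X (.efr k) with hE
  -- count-pour the end contents
  have h1 := runs_countPour (a := ir (.r k)) (b := sx (K := K) .w1) (cs := [cr (ar .x)]) (by simp)
    (by simp) (by simp) (by simp) R (sst (st (AReg.file [] [] zv [] [] [] [] []) M G) I X) rfl
  set I₁ := update I (.r k) [] with hI₁
  set X₁ := update X .w1 R.reverse with hX₁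
  have e1 : (fun r : SR K => if r = ir (IReg.r k) then [] else if r = sx SX.w1 then
      R.reverse ++ sst (st (AReg.file [] [] zv [] [] [] [] []) M G) I X (sx SX.w1)
      else if r ∈ [cr (ar AReg.x)] then
        ones R.length ++ sst (st (AReg.file [] [] zv [] [] [] [] []) M G) I X r
      else sst (st (AReg.file [] [] zv [] [] [] [] []) M G) I X r) =
      sst (st (AReg.file (ones R.length) [] zv [] [] [] [] []) M G) I₁ X₁ := by
    funext r
    rcases r with c | i | z
    · rcases c with (a | m) | g
      · have e : (Sum.inl (Sum.inl (Sum.inl a)) : SR K) = cr (ar a) := rfl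
        rw [e, if_neg (by simp), if_neg (by simp)]
        by_cases ha : a = .x
        · subst ha; simp
        · rw [if_neg (by simp [ha])]
          cases a <;> simp at ha <;> rfl
      · have e : (Sum.inl (Sum.inl (Sum.inr m)) : SR K) = cr (mo m) := rfl
        rw [e, if_neg (by simp), if_neg (by simp), if_neg (by simp [mo, ar])]
        simp
      · have e : (Sum.inl (Sum.inr g) : SR K) = cr (kr g) := rfl
        rw [e, if_neg (by simp), if_neg (by simp), if_neg (by simp [kr, ar])]
        simp
    · have e : (Sum.inr (Sum.inl i) : SR K) = ir i := rfl
      rw [e]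
      by_cases hi : i = .r k
      · subst hi; simp [I₁]
      · rw [if_neg (by simpa using hi), if_neg (by simp), if_neg (by simp)]
        simp [I₁, update_of_ne hi]
    · have e : (Sum.inr (Sum.inr z) : SR K) = sx z := rfl
      rw [e, if_neg (by simp)]
      by_cases hz : z = .w1
      · subst hz; simp [X₁, hw1]
      · rw [if_neg (by simpa using hz), if_neg (by simp)]
        simp [X₁, update_of_ne hz]
  rw [e1] at h1
  replace h1 := h1.mono (show _ ≤ 4 * R.length + 1 by norm_num)
  -- end height in binary
  have h2 := runs_binTo .pb R.length zv M G I₁ X₁ hpb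
  set G₂ := update G .pb (encodeNat R.length) with hG₂
  -- pour the claimed end fragment
  have h3 := runs_pour (a := sx (.efr k)) (b := sx (K := K) .w2) (by simp)
    (sst (st (AReg.file [] [] zv [] [] [] [] []) M G₂) I₁ X₁)
  have eE : X₁ (.efr k) = E := by rw [hE]; simp [X₁]
  have eW2 : X₁ .w2 = [] := by simp [X₁, hw2]
  simp only [sst_sx, eE, eW2, List.append_nil, update_sst_sx] at h3
  set X₃ := update (update X₁ (.efr k) []) .w2 E.reverse with hX₃
  -- compare
  have h4 := runs_eqChk (a := sx (K := K) .w1) (b := sx .w2) (g := cr (ar .g)) (by simp) (by simp)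
    (by simp) R.reverse E.reverse (sst (st (AReg.file [] [] zv [] [] [] [] []) M G₂) I₁ X₃) false
    (by simp [X₃, X₁]) (by simp [X₃]) (by simp)
  simp only [update_sst_sx, update_sst_cr, update_st_ar, AReg.update_file_g, Bool.false_or,
    List.reverse_inj] at h4
  set X₄ := update (update X₃ .w1 []) .w2 [] with hX₄
  have h5 := runs_crP (runs_tstN [] [] zv (!decide (R = E)) o M G₂ (by simp [G₂, hok])) I₁ X₄
  simp only [Bool.not_not] at h5
  set G₅ := update G₂ .ok (flag (o && decide (R = E))) with hG₅
  -- the minimum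
  have h6 := runs_pour (a := ir (.mn k)) (b := cr (K := K) (ar .x)) (by simp)
    (sst (st (AReg.file [] [] zv [] [] [] [] []) M G₅) I₁ X₄)
  have emn : I₁ (.mn k) = ones smin := by simp [I₁, hmn]
  simp only [sst_ir, emn, sst_cr, st_ar, AReg.file_x, List.append_nil, ones, List.reverse_replicate,
    update_sst_ir, update_sst_cr, update_st_ar, AReg.update_file_x, List.length_replicate] at h6
  set I₆ := update I₁ (.mn k) [] with hI₆
  have h7 := runs_binTo .pc smin zv M G₅ I₆ X₄ (by simp [G₅, G₂, hpc])
  set G₇ := update G₅ .pc (encodeNat smin) with hG₇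
  -- the maximum
  have h8 := runs_pour (a := ir (.mx k)) (b := cr (K := K) (ar .x)) (by simp)
    (sst (st (AReg.file [] [] zv [] [] [] [] []) M G₇) I₆ X₄)
  have emx : I₆ (.mx k) = ones smax := by simp [I₆, I₁, hmx]
  simp only [sst_ir, emx, sst_cr, st_ar, AReg.file_x, List.append_nil, ones, List.reverse_replicate,
    update_sst_ir, update_sst_cr, update_st_ar, AReg.update_file_x, List.length_replicate] at h8
  set I₈ := update I₆ (.mx k) [] with hI₈
  have h9 := runs_binTo .pd smax zv M G₇ I₈ X₄ (by simp [G₇, G₅, G₂, hpd])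
  set G₉ := update G₇ .pd (encodeNat smax) with hG₉
  -- discard the difference counters
  have h10 := runs_clear (ir (.dn k)) (sst (st (AReg.file [] [] zv [] [] [] [] []) M G₉) I₈ X₄)
  simp only [sst_ir, update_sst_ir] at h10
  have h11 := runs_clear (ir (.up k))
    (sst (st (AReg.file [] [] zv [] [] [] [] []) M G₉) (update I₈ (.dn k) []) X₄)
  simp only [sst_ir, update_sst_ir] at h11
  have edn : (I₈ (.dn k)).length = (I (.dn k)).length := by simp [I₈, I₆, I₁]
  have eup : (update I₈ (.dn k) [] (.up k)).length = (I (.up k)).length := by simp [I₈, I₆, I₁]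
  rw [edn] at h10
  rw [eup] at h11
  refine (h1.seq (h2.seq (h3.seq (h4.seq (h5.seq (h6.seq (h7.seq (h8.seq (h9.seq (h10.seq
    h11)))))))))).of_eq ?_ ?_
  · simp only [G₉, G₇, G₅, G₂, I₈, I₆, I₁, X₄, X₃, X₁]
    congr 1
    funext z
    rcases eq_or_ne z .w2 with rfl | hz2
    · simp [hw2]
    · rw [update_of_ne hz2]
      rcases eq_or_ne z .w1 with rfl | hz1
      · simp [hw1]
      · rw [update_of_ne hz1, update_of_ne hz2]
        rcases eq_or_ne z (.efr k) with rfl | hz3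
        · simp
        · rw [update_of_ne hz3, update_of_ne hz3, update_of_ne hz1]
  · simp only [List.length_reverse]
    omega

/-! ### Fetching the claimed numbers of one stack -/

/-- A sequence of moves from input registers to check registers (temporary `s`). [folklore] -/
def moves : List (SX K × KR) → Com (SR K)
  | [] => skip
  | (z, g) :: L => move (sx z) (cr (kr g)) (cr (ar .s)) ;; moves L

/-- The check bank after the moves. [folklore] -/
def mvG : Regs KR → Regs (SX K) → List (SX K × KR) → Regs KR
  | G, _, [] => G
  | G, X, (z, g) :: L => mvG (update G g (X z)) (update X z []) L

/-- The input bank after the moves. [folklore] -/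
def mvX : Regs (SX K) → List (SX K × KR) → Regs (SX K)
  | X, [] => X
  | X, (z, _) :: L => mvX (update X z []) L

/-- The cost of the moves. [folklore] -/
def mvCost : Regs (SX K) → List (SX K × KR) → ℕ
  | _, [] => 0
  | X, (z, _) :: L => 6 * (X z).length + 2 + mvCost (update X z []) L

/-- Simulation of `moves` (targets distinct and initially empty). [folklore] -/
theorem runs_moves (A : Regs AReg) (hs : A .s = []) (M : Regs MOwn) (I : Regs (IReg K)) :
    ∀ (L : List (SX K × KR)), (L.map Prod.snd).Nodup → ∀ (G : Regs KR) (X : Regs (SX K)),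
      (∀ p ∈ L, G p.2 = []) →
      Runs (moves L) (sst (st A M G) I X) (sst (st A M (mvG G X L)) I (mvX X L)) (mvCost X L)
  | [], _, G, X, _ => by simpa [moves, mvG, mvX, mvCost] using Runs.skip (sst (st A M G) I X)
  | (z, g) :: L, hnd, G, X, hG => by
    simp only [List.map_cons, List.nodup_cons] at hnd
    have h1 := runs_move (a := sx z) (b := cr (K := K) (kr g)) (t := cr (ar .s)) (by simp) (by simp)
      (by simp) (sst (st A M G) I X) (by simpa using hs)
    have hg : G g = [] := hG (z, g) (by simp)
    simp only [sst_sx, sst_cr, st_kr, hg, List.append_nil, update_sst_sx, update_sst_cr,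
      update_st_kr] at h1
    have h2 := runs_moves A hs M I L hnd.2 (update G g (X z)) (update X z []) (by
      intro p hp
      have hne : p.2 ≠ g := fun e => hnd.1 (by rw [← e]; exact List.mem_map_of_mem hp)
      rw [update_of_ne hne]; exact hG p (by simp [hp]))
    exact (h1.seq h2).of_eq (by simp [mvG, mvX]) (by simp [mvCost])

/-- The fields of stack `k` and their destinations. [folklore] -/
def fieldsK (k : Fin K) : List (SX K × KR) :=
  [(.htu k, .ht), (.ht1 k, .hi), (.cutu k, .cut), (.mnu k, .mn), (.mxu k, .mx), (.lou k, .lo),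
    (.hibu k, .hib), (.lenf k, .pa)]

/-- **Fetching stack `k`**: move its eight numerals into the check bank, copy `c1`. [folklore] -/
def fetchK (k : Fin K) : Com (SR K) :=
  moves (fieldsK k) ;; copy (sx .c1) (cr (kr .c1)) (cr (ar .s)) (cr (ar .t))

/-- The check bank after fetching stack `k`. [folklore] -/
def Gfetch (G : Regs KR) (X : Regs (SX K)) (k : Fin K) : Regs KR :=
  update (update (update (update (update (update (update (update (update G
    .ht (X (.htu k))) .hi (X (.ht1 k))) .cut (X (.cutu k))) .mn (X (.mnu k))) .mx (X (.mxu k)))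
    .lo (X (.lou k))) .hib (X (.hibu k))) .pa (X (.lenf k))) .c1 (X .c1)

/-- The input bank after fetching stack `k`. [folklore] -/
def Xfetch (X : Regs (SX K)) (k : Fin K) : Regs (SX K) :=
  update (update (update (update (update (update (update (update X
    (.htu k) []) (.ht1 k) []) (.cutu k) []) (.mnu k) []) (.mxu k) []) (.lou k) []) (.hibu k) [])
    (.lenf k) []

/-- The total length of the numerals of stack `k`. [folklore] -/
def flen (X : Regs (SX K)) (k : Fin K) : ℕ :=
  (X (.htu k)).length + (X (.ht1 k)).length + (X (.cutu k)).length + (X (.mnu k)).length +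
    (X (.mxu k)).length + (X (.lou k)).length + (X (.hibu k)).length + (X (.lenf k)).length

/-- **Simulation of `fetchK`.** [folklore] -/
theorem runs_fetchK (k : Fin K) (zv : List Bool) (M : Regs MOwn) (G : Regs KR) (I : Regs (IReg K))
    (X : Regs (SX K)) (hht : G .ht = []) (hhi : G .hi = []) (hcut : G .cut = []) (hmn : G .mn = [])
    (hmx : G .mx = []) (hlo : G .lo = []) (hhib : G .hib = []) (hpa : G .pa = []) (hc1 : G .c1 = []) :
    Runs (fetchK k) (sst (st (AReg.file [] [] zv [] [] [] [] []) M G) I X)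
      (sst (st (AReg.file [] [] zv [] [] [] [] []) M (Gfetch G X k)) I (Xfetch X k))
      (6 * flen X k + 10 * (X SX.c1).length + 19) := by
  have h1 := runs_moves (AReg.file [] [] zv [] [] [] [] []) rfl M I (fieldsK k)
    (by simp [fieldsK]) G X (by
      intro p hp
      simp only [fieldsK, List.mem_cons, List.not_mem_nil, or_false] at hp
      rcases hp with rfl | rfl | rfl | rfl | rfl | rfl | rfl | rfl <;> assumption)
  have h2 := runs_copy (a := sx (K := K) .c1) (b := cr (kr .c1)) (t := cr (ar .s)) (u := cr (ar .t))
    (by simp) (by simp) (by simp) (by simp) (by simp) (by simp)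
    (sst (st (AReg.file [] [] zv [] [] [] [] []) M (mvG G X (fieldsK k))) I (mvX X (fieldsK k)))
    rfl rfl
  have ec1 : mvX X (fieldsK k) .c1 = X .c1 := by simp [mvX, fieldsK]
  have ec1' : mvG G X (fieldsK k) .c1 = [] := by simp [mvG, fieldsK, hc1]
  simp only [sst_sx, ec1, sst_cr, st_kr, ec1', List.append_nil, update_sst_cr, update_st_kr] at h2
  refine (h1.seq h2).of_eq ?_ ?_
  · simp [mvG, mvX, fieldsK, Gfetch, Xfetch]
  · simp only [mvCost, fieldsK, flen, ne_eq, update_of_ne, not_false_eq_true, reduceCtorEq]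
    simp
    omega

/-! ### Checking one stack -/

/-- The per-stack registers of the check bank are clean. [folklore] -/
def SimClean (G : Regs KR) : Prop := ∀ g ∈ simRegs, G g = []

/-- A clean bank is its own clearing. [folklore] -/
theorem cleared_eq_self_of_simClean {G : Regs KR} (h : SimClean G) : cleared G simRegs = G := by
  funext g
  by_cases hg : g ∈ simRegs
  · rw [cleared_of_mem _ _ _ hg, h g hg]
  · rw [cleared_of_not_mem _ _ _ hg]

/-- **Checking stack `k`**: unload, fetch, test. [folklore] -/
def checkK (k : Fin K) : Com (SR K) := unloadK k ;; fetchK k ;; crP simTests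

/-- **The outcome of the check of stack `k`** on the values: end contents, (a), (r), (c),
(e min), (e max), (f). [folklore] -/
def kVal (X : Regs (SX K)) (k : Fin K) (f0 : ℕ) (R : List Bool) (smin smax : ℕ) : Bool :=
  decide (R = X (.efr k)) &&
    (decide (f0 + bitsToNat (X (.cutu k)) = bitsToNat (X (.htu k))) &&
      (decide (bitsToNat (X (.lou k)) = 0) || decide (bitsToNat (X .c1) ≤ f0)) &&
      decide (R.length + bitsToNat (X (.cutu k)) = bitsToNat (X (.ht1 k))) &&
      decide (smin + bitsToNat (X (.cutu k)) = bitsToNat (X (.mnu k))) &&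
      decide (smax + bitsToNat (X (.cutu k)) = bitsToNat (X (.mxu k))) &&
      decide (bitsToNat (X (.htu k)) ≤ bitsToNat (X (.hibu k))))

/-- The interpreter bank after checking stack `k`. [folklore] -/
def Icheck (I : Regs (IReg K)) (k : Fin K) : Regs (IReg K) :=
  update (update (update (update (update I (.r k) []) (.mn k) []) (.mx k) []) (.dn k) []) (.up k) []

/-- The input bank after checking stack `k`. [folklore] -/
def Xcheck (X : Regs (SX K)) (k : Fin K) : Regs (SX K) := Xfetch (update X (.efr k) []) k

/-- **Simulation of the check of stack `k`.** [folklore] -/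
theorem runs_checkK (k : Fin K) (o : Bool) (zv : List Bool) (M : Regs MOwn) (G : Regs KR)
    (I : Regs (IReg K)) (X : Regs (SX K)) (f0 smin smax : ℕ) (hok : G .ok = flag o)
    (hcl : SimClean G) (hmn : I (.mn k) = ones smin) (hmx : I (.mx k) = ones smax)
    (hw1 : X .w1 = []) (hw2 : X .w2 = []) (hlen : X (.lenf k) = encodeNat f0) :
    Runs (checkK k) (sst (st (AReg.file [] [] zv [] [] [] [] []) M G) I X)
      (sst (st (AReg.file [] [] zv [] [] [] [] []) M
        (update G .ok (flag (o && kVal X k f0 (I (.r k)) smin smax)))) (Icheck I k) (Xcheck X k))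
      (440 * ((I (IReg.r k)).length + smin + smax + flen X k + (X SX.c1).length) +
        9 * (X (SX.efr k)).length + 2 * ((I (IReg.dn k)).length + (I (IReg.up k)).length) + 940) := by
  have hc : ∀ g, g ∈ simRegs → G g = [] := hcl
  have h1 := runs_unloadK k o zv M G I X smin smax hok (hc _ (by simp [simRegs]))
    (hc _ (by simp [simRegs])) (hc _ (by simp [simRegs])) hmn hmx hw1 hw2
  set R := I (.r k) with hR
  set o₁ := o && decide (R = X (.efr k)) with ho₁
  set G₁ := update (update (update (update G .pb (encodeNat R.length)) .ok (flag o₁)) .pc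
    (encodeNat smin)) .pd (encodeNat smax) with hG₁
  set X₁ := update X (.efr k) [] with hX₁
  have h2 := runs_fetchK k zv M G₁ (Icheck I k) X₁ (by simp [G₁, hc .ht (by simp [simRegs])])
    (by simp [G₁, hc .hi (by simp [simRegs])]) (by simp [G₁, hc .cut (by simp [simRegs])])
    (by simp [G₁, hc .mn (by simp [simRegs])]) (by simp [G₁, hc .mx (by simp [simRegs])])
    (by simp [G₁, hc .lo (by simp [simRegs])]) (by simp [G₁, hc .hib (by simp [simRegs])])
    (by simp [G₁, hc .pa (by simp [simRegs])]) (by simp [G₁, hc .c1 (by simp [simRegs])])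
  set G₂ := Gfetch G₁ X₁ k with hG₂
  have h3 := runs_crP (runs_simTests o₁ zv M G₂ (by simp [G₂, Gfetch, G₁])
    (by simp [G₂, Gfetch, G₁, hc .t (by simp [simRegs])])
    (by simp [G₂, Gfetch, G₁, hc .mnp (by simp [simRegs])])
    (by simp [G₂, Gfetch, G₁, hc .mxp (by simp [simRegs])])) (Icheck I k) (Xfetch X₁ k)
  -- the outcome
  have ev : simKVal G₂ = (decide (f0 + bitsToNat (X (.cutu k)) = bitsToNat (X (.htu k))) &&
      (decide (bitsToNat (X (.lou k)) = 0) || decide (bitsToNat (X .c1) ≤ f0)) &&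
      decide (R.length + bitsToNat (X (.cutu k)) = bitsToNat (X (.ht1 k))) &&
      decide (smin + bitsToNat (X (.cutu k)) = bitsToNat (X (.mnu k))) &&
      decide (smax + bitsToNat (X (.cutu k)) = bitsToNat (X (.mxu k))) &&
      decide (bitsToNat (X (.htu k)) ≤ bitsToNat (X (.hibu k)))) := by
    simp [simKVal, rVal, G₂, Gfetch, G₁, X₁, hlen, bitsToNat_encodeNat]
  -- the final bank
  have efin : update (cleared G₂ simRegs) .ok (flag (o₁ && simKVal G₂)) =
      update G .ok (flag (o && kVal X k f0 R smin smax)) := by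
    have e1 : cleared G₂ simRegs = update G .ok (flag o₁) := by
      funext g
      by_cases hg : g ∈ simRegs
      · rw [cleared_of_mem _ _ _ hg]
        have hgo : g ≠ .ok := by rintro rfl; simp [simRegs] at hg
        rw [update_of_ne hgo, hc g hg]
      · rw [cleared_of_not_mem _ _ _ hg]
        simp only [simRegs, List.mem_cons, List.not_mem_nil, or_false, not_or] at hg
        obtain ⟨n1, n2, n3, n4, n5, n6, n7, n8, n9, n10, n11, n12, n13, n14, n15⟩ := hg
        by_cases hgo : g = .ok
        · subst hgo; simp [G₂, Gfetch, G₁]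
        · simp [G₂, Gfetch, G₁, update_of_ne, hgo, n1, n2, n3, n4, n5, n6, n7, n8, n9, n10, n11, n12]
    rw [e1, update_idem, ev]
    simp only [kVal, ho₁, Bool.and_assoc]
  -- the cost
  have hks : ksum G₂ ≤ flen X k + (X .c1).length + R.length + smin + smax := by
    have l1 := length_encodeNat_le R.length
    have l2 := length_encodeNat_le smin
    have l3 := length_encodeNat_le smax
    simp only [ksum, G₂, Gfetch, G₁, X₁, flen]
    simp
    omega
  have hfl : flen X₁ k = flen X k := by simp [flen, X₁]
  have hc1 : (X₁ .c1).length = (X .c1).length := by simp [X₁]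
  rw [hfl, hc1] at h2
  refine (h1.seq (h2.seq h3)).of_eq ?_ ?_
  · rw [efin]; rfl
  · omega

/-! ### Checking all stacks -/

/-- Checking a list of stacks. [folklore] -/
def checkList : List (Fin K) → Com (SR K)
  | [] => skip
  | k :: ks => checkK k ;; checkList ks

/-- `kVal` of another stack ignores the check of stack `k`. [folklore] -/
theorem kVal_Xcheck (X : Regs (SX K)) {k k' : Fin K} (h : k' ≠ k) (f0 : ℕ) (R : List Bool)
    (smin smax : ℕ) : kVal (Xcheck X k) k' f0 R smin smax = kVal X k' f0 R smin smax := by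
  simp [kVal, Xcheck, Xfetch, h]

/-- `flen` of another stack ignores the check of stack `k`. [folklore] -/
theorem flen_Xcheck (X : Regs (SX K)) {k k' : Fin K} (h : k' ≠ k) : flen (Xcheck X k) k' = flen X k' := by
  simp [flen, Xcheck, Xfetch, h]

/-- The conjunction of the per-stack outcomes. [folklore] -/
def allK (X : Regs (SX K)) (f0 : Fin K → ℕ) (R : Fin K → List Bool) (smin smax : Fin K → ℕ) :
    List (Fin K) → Bool
  | [] => true
  | k :: ks => kVal X k (f0 k) (R k) (smin k) (smax k) && allK X f0 R smin smax ks

/-- The interpreter bank after checking the stacks of `ks`. [folklore] -/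
def IcheckL (I : Regs (IReg K)) : List (Fin K) → Regs (IReg K)
  | [] => I
  | k :: ks => IcheckL (Icheck I k) ks

/-- The input bank after checking the stacks of `ks`. [folklore] -/
def XcheckL (X : Regs (SX K)) : List (Fin K) → Regs (SX K)
  | [] => X
  | k :: ks => XcheckL (Xcheck X k) ks

/-- The cost of checking the stacks of `ks`. [folklore] -/
def checkCost (I : Regs (IReg K)) (X : Regs (SX K)) (smin smax : Fin K → ℕ) (ks : List (Fin K)) : ℕ :=
  (ks.map fun k => 440 * ((I (.r k)).length + smin k + smax k + flen X k + (X .c1).length) +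
    9 * (X (.efr k)).length + 2 * ((I (.dn k)).length + (I (.up k)).length) + 940).sum

/-- **Simulation of `checkList`.** [folklore] -/
theorem runs_checkList (zv : List Bool) (M : Regs MOwn) (smin smax f0 : Fin K → ℕ) :
    ∀ (ks : List (Fin K)), ks.Nodup → ∀ (o : Bool) (G : Regs KR) (I : Regs (IReg K)) (X : Regs (SX K)),
      G .ok = flag o → SimClean G → X .w1 = [] → X .w2 = [] →
      (∀ k ∈ ks, I (.mn k) = ones (smin k) ∧ I (.mx k) = ones (smax k) ∧ X (.lenf k) = encodeNat (f0 k)) →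
      Runs (checkList ks) (sst (st (AReg.file [] [] zv [] [] [] [] []) M G) I X)
        (sst (st (AReg.file [] [] zv [] [] [] [] []) M
          (update G .ok (flag (o && allK X f0 (fun k => I (.r k)) smin smax ks))))
          (IcheckL I ks) (XcheckL X ks))
        (checkCost I X smin smax ks)
  | [], _, o, G, I, X, hok, _, _, _, _ => by
    refine (Runs.skip _).of_eq ?_ (by simp [checkCost])
    simp only [allK, Bool.and_true, IcheckL, XcheckL]
    rw [← hok, update_eq_self]
  | k :: ks, hnd, o, G, I, X, hok, hcl, hw1, hw2, hks => by
    rw [List.nodup_cons] at hnd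
    obtain ⟨hmn, hmx, hlen⟩ := hks k (by simp)
    have h1 := runs_checkK k o zv M G I X (f0 k) (smin k) (smax k) hok hcl hmn hmx hw1 hw2 hlen
    set o₁ := o && kVal X k (f0 k) (I (.r k)) (smin k) (smax k) with ho₁
    have h2 := runs_checkList zv M smin smax f0 ks hnd.2 o₁ (update G .ok (flag o₁)) (Icheck I k)
      (Xcheck X k) (by simp) (by
        intro g hg
        have hgo : g ≠ .ok := by rintro rfl; simp [simRegs] at hg
        rw [update_of_ne hgo]; exact hcl g hg)
      (by simp [Xcheck, Xfetch, hw1]) (by simp [Xcheck, Xfetch, hw2]) (by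
        intro k' hk'
        have hne : k' ≠ k := by rintro rfl; exact hnd.1 hk'
        obtain ⟨a1, a2, a3⟩ := hks k' (by simp [hk'])
        exact ⟨by simp [Icheck, hne, a1], by simp [Icheck, hne, a2], by simp [Xcheck, Xfetch, hne, a3]⟩)
    have eall : allK (Xcheck X k) f0 (fun k' => Icheck I k (.r k')) smin smax ks =
        allK X f0 (fun k' => I (.r k')) smin smax ks := by
      clear h2
      induction ks with
      | nil => rfl
      | cons k' ks ih =>
        have hne : k' ≠ k := by rintro rfl; exact hnd.1 (by simp)
        have hnd' : k ∉ ks := fun h => hnd.1 (by simp [h])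
        simp only [allK]
        rw [ih ⟨hnd', (List.nodup_cons.1 hnd.2).2⟩ (fun j hj => hks j (by
          simp only [List.mem_cons] at hj ⊢; tauto)), kVal_Xcheck X hne]
        simp [Icheck, hne]
    have ecost : checkCost (Icheck I k) (Xcheck X k) smin smax ks = checkCost I X smin smax ks := by
      unfold checkCost
      congr 1
      apply List.map_congr_left
      intro k' hk'
      have hne : k' ≠ k := by rintro rfl; exact hnd.1 hk'
      rw [flen_Xcheck X hne]
      simp [Icheck, Xcheck, Xfetch, hne]
    rw [eall, ecost, update_idem] at h2
    refine (h1.seq h2).of_eq ?_ ?_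
    · simp only [allK, ho₁, Bool.and_assoc, IcheckL, XcheckL]
    · simp [checkCost]

/-! ### The control test -/

/-- **The control test**: the simulated counter (capped) against the claimed next counter
(capped): `ok := ok ∧ (min pc' |P| = min pc₁ |P|)`. [folklore] -/
def pcTest (np : ℕ) : Com (SR K) :=
  unitsN (cr (ar .y)) np ;; capLoop (sx .pc1) (cr (ar .y)) (cr (ar .x)) ;; clear (cr (ar .y)) ;;
    eqChk (ir .pc) (cr (ar .x)) (cr (ar .g)) ;; crP tstN

/-- `1ᵃ = 1ᵇ ↔ a = b`. [folklore] -/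
theorem ones_inj {a b : ℕ} : ones a = ones b ↔ a = b :=
  ⟨fun h => by simpa [ones] using congrArg List.length h, fun h => by rw [h]⟩

/-- Simulation of `pcTest`. [folklore] -/
theorem runs_pcTest (np q : ℕ) (o : Bool) (zv : List Bool) (M : Regs MOwn) (G : Regs KR)
    (I : Regs (IReg K)) (X : Regs (SX K)) (hok : G .ok = flag o) (hpc : I .pc = ones q) (hq : q ≤ np) :
    Runs (pcTest np) (sst (st (AReg.file [] [] zv [] [] [] [] []) M G) I X)
      (sst (st (AReg.file [] [] zv [] [] [] [] []) M
        (update G .ok (flag (o && decide (q = min (X .pc1).length np))))) (update I .pc [])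
        (update X .pc1 []))
      (17 * np + 5 * (X SX.pc1).length + 10) := by
  have h1 := runs_unitsN (cr (ar .y) : SR K) np (sst (st (AReg.file [] [] zv [] [] [] [] []) M G) I X)
  simp only [sst_cr, st_ar, AReg.file_y, List.append_nil, update_sst_cr, update_st_ar,
    AReg.update_file_y] at h1
  have h2 := runs_capLoop (a := sx (K := K) .pc1) (f := cr (ar .y)) (c := cr (ar .x)) (by simp)
    (by simp) (by simp) (X .pc1) np (sst (st (AReg.file [] (ones np) zv [] [] [] [] []) M G) I X)
    rfl rfl
  simp only [sst_cr, st_ar, AReg.file_x, List.append_nil, update_sst_sx, update_sst_cr,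
    update_st_ar, AReg.update_file_y, AReg.update_file_x] at h2
  set m := min (X .pc1).length np with hm
  have h3 := runs_clear (cr (ar .y) : SR K)
    (sst (st (AReg.file (ones m) (ones (np - (X .pc1).length)) zv [] [] [] [] []) M G) I
      (update X .pc1 []))
  simp only [sst_cr, st_ar, AReg.file_y, update_sst_cr, update_st_ar, AReg.update_file_y, ones,
    List.length_replicate] at h3
  have h4 := runs_eqChk (a := ir (K := K) .pc) (b := cr (ar .x)) (g := cr (ar .g)) (by simp) (by simp)
    (by simp) (ones q) (ones m)
    (sst (st (AReg.file (ones m) [] zv [] [] [] [] []) M G) I (update X .pc1 [])) false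
    (by simp [hpc]) (by simp) (by simp)
  simp only [update_sst_ir, update_sst_cr, update_st_ar, AReg.update_file_x, AReg.update_file_g,
    Bool.false_or, ones_inj] at h4
  have h5 := runs_crP (runs_tstN [] [] zv (!decide (q = m)) o M G hok) (update I .pc [])
    (update X .pc1 [])
  simp only [Bool.not_not] at h5
  refine (h1.seq (h2.seq (h3.seq (h4.seq h5)))).of_eq rfl ?_
  simp only [ones, List.length_replicate]
  omega

/-! ### Heights and statistics of the simulated run -/

/-- A step grows a register by at most one symbol. [folklore] -/
theorem length_regs_step_le (P : AProg Bool (Fin K)) (c : ACfg Bool (Fin K)) (k : Fin K) :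
    ((P.step c).regs k).length ≤ (c.regs k).length + 1 := by
  unfold AProg.step
  rcases P[c.pc]? with _ | ⟨k', a⟩ | ⟨k', j⟩ | j
  · simp
  · simp only
    by_cases h : k = k'
    · subst h; simp
    · rw [update_of_ne h]; omega
  · simp only
    rcases hk : c.regs k' with _ | ⟨a, w⟩
    · simp
    · simp only
      by_cases h : k = k'
      · subst h; rw [update_self, hk]; simp only [List.length_cons]; omega
      · rw [update_of_ne h]; omega
  · simp

/-- `t` steps grow a register by at most `t` symbols. [folklore] -/
theorem length_regs_iterate_le (P : AProg Bool (Fin K)) (c : ACfg Bool (Fin K)) (k : Fin K) :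
    ∀ t, ((P.step^[t] c).regs k).length ≤ (c.regs k).length + t
  | 0 => by simp
  | t + 1 => by
    rw [Function.iterate_succ_apply']
    have := length_regs_step_le P (P.step^[t] c) k
    have := length_regs_iterate_le P c k t
    omega

/-- The running minimum never exceeds its initial value. [folklore] -/
theorem statMin_le (P : AProg Bool (Fin K)) (f : ℕ) (c : ACfg Bool (Fin K)) (mn : Fin K → ℕ)
    (k : Fin K) (hmn : ∀ k, mn k ≤ (c.regs k).length) : PPSTInterp.statMin P f c mn k ≤ mn k :=
  (PPSTInterp.statMin_spec P f c mn k hmn).2.1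

/-- The running maximum from the start heights is at most the start height plus the fuel.
[folklore] -/
theorem statMax_le (P : AProg Bool (Fin K)) (f : ℕ) (c : ACfg Bool (Fin K)) (k : Fin K) :
    PPSTInterp.statMax P f c (fun k => (c.regs k).length) k ≤ (c.regs k).length + f := by
  rcases (PPSTInterp.statMax_spec P f c (fun k => (c.regs k).length) k (fun _ => le_rfl)).2.2 with
    h | ⟨t, ht, h⟩
  · rw [h]; omega
  · rw [h]; have := length_regs_iterate_le P c k t; omega

/-! ### The whole check -/

/-- The banks after checking the stacks of `ks`, pointwise. [folklore] -/
theorem IcheckL_apply (I : Regs (IReg K)) : ∀ (ks : List (Fin K)) (i : IReg K),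
    IcheckL I ks i = match i with
      | .r k | .mn k | .mx k | .dn k | .up k => if k ∈ ks then [] else I i
      | _ => I i
  | [], i => by cases i <;> simp [IcheckL]
  | k :: ks, i => by
    rw [IcheckL, IcheckL_apply (Icheck I k) ks i]
    cases i with
    | r k' => by_cases h : k' = k <;> simp [Icheck, h]
    | mn k' => by_cases h : k' = k <;> simp [Icheck, h]
    | mx k' => by_cases h : k' = k <;> simp [Icheck, h]
    | dn k' => by_cases h : k' = k <;> simp [Icheck, h]
    | up k' => by_cases h : k' = k <;> simp [Icheck, h]
    | pc => simp [Icheck]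
    | fuel => simp [Icheck]

/-- The input bank after checking the stacks of `ks`, pointwise. [folklore] -/
theorem XcheckL_apply (X : Regs (SX K)) : ∀ (ks : List (Fin K)) (z : SX K),
    XcheckL X ks z = match z with
      | .efr k | .htu k | .ht1 k | .cutu k | .mnu k | .mxu k | .lou k | .hibu k | .lenf k =>
          if k ∈ ks then [] else X z
      | _ => X z
  | [], z => by cases z <;> simp [XcheckL]
  | k :: ks, z => by
    rw [XcheckL, XcheckL_apply (Xcheck X k) ks z]
    cases z with
    | efr k' => by_cases h : k' = k <;> simp [Xcheck, Xfetch, h]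
    | htu k' => by_cases h : k' = k <;> simp [Xcheck, Xfetch, h]
    | ht1 k' => by_cases h : k' = k <;> simp [Xcheck, Xfetch, h]
    | cutu k' => by_cases h : k' = k <;> simp [Xcheck, Xfetch, h]
    | mnu k' => by_cases h : k' = k <;> simp [Xcheck, Xfetch, h]
    | mxu k' => by_cases h : k' = k <;> simp [Xcheck, Xfetch, h]
    | lou k' => by_cases h : k' = k <;> simp [Xcheck, Xfetch, h]
    | hibu k' => by_cases h : k' = k <;> simp [Xcheck, Xfetch, h]
    | lenf k' => by_cases h : k' = k <;> simp [Xcheck, Xfetch, h]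
    | fr k' => simp [Xcheck, Xfetch]
    | pcu => simp [Xcheck, Xfetch]
    | pc1 => simp [Xcheck, Xfetch]
    | ub => simp [Xcheck, Xfetch]
    | c1 => simp [Xcheck, Xfetch]
    | w1 => simp [Xcheck, Xfetch]
    | w2 => simp [Xcheck, Xfetch]

/-- `allK` only reads the per-stack claims and `c1`. [folklore] -/
theorem allK_congr {X X' : Regs (SX K)} (h : ∀ k f R a b, kVal X' k f R a b = kVal X k f R a b)
    (f0 : Fin K → ℕ) (R : Fin K → List Bool) (smin smax : Fin K → ℕ) :
    ∀ ks, allK X' f0 R smin smax ks = allK X f0 R smin smax ks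
  | [] => rfl
  | k :: ks => by simp only [allK, h, allK_congr h f0 R smin smax ks]

/-- The input bank after loading. [folklore] -/
def XL (X : Regs (SX K)) : Regs (SX K)
  | .fr _ => []
  | .lenf k => encodeNat (X (.fr k)).length
  | .pcu => []
  | .ub => []
  | z => X z

/-- **The re-simulation check**: load, simulate, check every stack, test the control, clean up.
[cite: PaulEtAl1983, §3] -/
def simChk (P : AProg Bool (Fin K)) : Com (SR K) :=
  loadList (List.finRange K) ;; loadPc P.length ;; loadFuel ;; irP (PPSTInterp.simLoop P) ;;
    checkList (List.finRange K) ;; pcTest P.length ;; clear (sx .c1)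

/-- The start configuration read off the inputs. [folklore] -/
def startA (X : Regs (SX K)) : ACfg Bool (Fin K) := ⟨(X .pcu).length, fun k => X (.fr k)⟩

/-- The start heights. [folklore] -/
def h0 (X : Regs (SX K)) : Fin K → ℕ := fun k => (X (.fr k)).length

/-- **The outcome of the re-simulation check** on the inputs. [folklore] -/
def simVal (P : AProg Bool (Fin K)) (X : Regs (SX K)) : Bool :=
  allK X (h0 X) (fun k => (P.step^[(X .ub).length] (startA X)).regs k)
      (PPSTInterp.statMin P (X .ub).length (startA X) (h0 X))
      (PPSTInterp.statMax P (X .ub).length (startA X) (h0 X)) (List.finRange K) &&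
    decide (min (P.step^[(X .ub).length] (startA X)).pc P.length = min (X .pc1).length P.length)

/-- The total length of the inputs. [folklore] -/
def xsum (X : Regs (SX K)) : ℕ := ∑ z : SX K, (X z).length

/-- One input is bounded by the total. [folklore] -/
theorem le_xsum (X : Regs (SX K)) (z : SX K) : (X z).length ≤ xsum X :=
  Finset.single_le_sum (f := fun z => (X z).length) (fun _ _ => Nat.zero_le _) (Finset.mem_univ z)

/-- A family of inputs is bounded by the total. [folklore] -/
theorem sum_le_xsum (X : Regs (SX K)) (f : Fin K → SX K) (hf : Injective f) :
    ∑ k : Fin K, (X (f k)).length ≤ xsum X := by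
  unfold xsum
  have e : ∑ k : Fin K, (X (f k)).length = ∑ z ∈ Finset.univ.map ⟨f, hf⟩, (X z).length := by
    rw [Finset.sum_map]; rfl
  rw [e]
  exact Finset.sum_le_sum_of_subset (by intro z _; exact Finset.mem_univ z)

/-- List sums over `finRange` are `Fintype` sums. [folklore] -/
theorem sum_finRange (g : Fin K → ℕ) : ((List.finRange K).map g).sum = ∑ k : Fin K, g k := by
  rw [← List.sum_toFinset _ (List.nodup_finRange K)]
  simp

/-- The seven claimed numerals of stack `k`. [folklore] -/
def F7 (X : Regs (SX K)) (k : Fin K) : ℕ :=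
  (X (.htu k)).length + (X (.ht1 k)).length + (X (.cutu k)).length + (X (.mnu k)).length +
    (X (.mxu k)).length + (X (.lou k)).length + (X (.hibu k)).length

/-- **Simulation of the re-simulation check.** From clean banks (interpreter bank empty, the
per-stack check registers and the scratch inputs empty), `simChk` consumes all its inputs,
returns to clean banks and folds its outcome into `ok`, within a number of steps linear in the
total input length (the slope depending on `K` and `|P|` only). [cite: PaulEtAl1983, §3] -/
theorem runs_simChk (P : AProg Bool (Fin K)) (o : Bool) (zv : List Bool) (M : Regs MOwn)
    (G : Regs KR) (X : Regs (SX K)) (hok : G .ok = flag o) (hcl : SimClean G) (hw1 : X .w1 = [])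
    (hw2 : X .w2 = []) (hlen : ∀ k, X (.lenf k) = []) :
    Runs (simChk P) (sst (st (AReg.file [] [] zv [] [] [] [] []) M G) (fun _ => []) X)
      (sst (st (AReg.file [] [] zv [] [] [] [] []) M (update G .ok (flag (o && simVal P X))))
        (fun _ => []) (fun _ => []))
      ((5000 + 1400 * K + 3 * P.length) * xsum X + 1000 * K + 20 * P.length + 100) := by
  set c₀ := startA X with hc₀
  set hh := h0 X with hhh
  set b := (X .ub).length with hb
  -- load the stacks
  have h1 := runs_loadList zv M G (List.finRange K) (List.nodup_finRange K) (fun _ => []) X hw1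
    (fun k _ => ⟨rfl, rfl, rfl, hlen k⟩)
  set I₁ := Iload (fun k => X (.fr k)) (fun _ => []) (List.finRange K) with hI₁
  set X₁ := Xload X (List.finRange K) with hX₁
  -- load the counter
  have h2 := runs_loadPc P.length [] zv M G I₁ X₁ (by simp [I₁, Iload])
  have epcu : X₁ .pcu = X .pcu := by simp [X₁, Xload]
  rw [epcu] at h2
  set I₂ := update I₁ .pc (ones (min (X .pcu).length P.length)) with hI₂
  set X₂ := update X₁ .pcu [] with hX₂
  -- load the fuel
  have h3 := runs_loadFuel (X .ub) (sst (st (AReg.file [] [] zv [] [] [] [] []) M G) I₂ X₂)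
    (by simp [X₂, X₁, Xload])
  simp only [sst_ir, update_sst_sx, update_sst_ir] at h3
  have efuel : I₂ .fuel = [] := by simp [I₂, I₁, Iload]
  rw [efuel, List.append_nil, ← hb] at h3
  set X₃ := update X₂ .ub [] with hX₃
  -- this is the interpreter's canonical start state
  have ecanon : update I₂ .fuel (ones b) = (PPSTInterp.canon P c₀ hh hh b).store := by
    funext i
    cases i <;> simp [I₂, I₁, Iload, PPSTInterp.canon, PPSTInterp.ISt.store, List.mem_finRange, c₀,
      startA, hh, h0]
  rw [ecanon] at h3
  -- simulate
  have h4 := runs_irP (PPSTInterp.runs_simLoop P b c₀ hh hh (fun _ => le_rfl) (fun _ => le_rfl))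
    (st (AReg.file [] [] zv [] [] [] [] []) M G) X₃
  set cT := P.step^[b] c₀ with hcT
  set sMin := PPSTInterp.statMin P b c₀ hh with hsMin
  set sMax := PPSTInterp.statMax P b c₀ hh with hsMax
  set I₄ := (PPSTInterp.canon P cT sMin sMax 0).store with hI₄
  -- check every stack
  have elen3 : ∀ k, X₃ (.lenf k) = encodeNat (hh k) := by
    intro k; simp [X₃, X₂, X₁, Xload, List.mem_finRange, hh, h0]
  have h5 := runs_checkList zv M sMin sMax hh (List.finRange K) (List.nodup_finRange K) o G I₄ X₃
    hok hcl (by simp [X₃, X₂, X₁, Xload, hw1]) (by simp [X₃, X₂, X₁, Xload, hw2])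
    (fun k _ => ⟨by simp [I₄, PPSTInterp.canon],
      by simp [I₄, PPSTInterp.canon], elen3 k⟩)
  have eR : (fun k => I₄ (.r k)) = fun k => cT.regs k := by
    funext k; simp [I₄, PPSTInterp.canon]
  have eallK : allK X₃ hh (fun k => I₄ (.r k)) sMin sMax (List.finRange K) =
      allK X hh (fun k => cT.regs k) sMin sMax (List.finRange K) := by
    rw [eR]
    exact allK_congr (fun k f R a' b' => by simp [kVal, X₃, X₂, X₁, Xload]) _ _ _ _ _
  rw [eallK] at h5
  set o₅ := o && allK X hh (fun k => cT.regs k) sMin sMax (List.finRange K) with ho₅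
  set I₅ := IcheckL I₄ (List.finRange K) with hI₅
  set X₅ := XcheckL X₃ (List.finRange K) with hX₅
  -- the control test
  have epc5 : I₅ .pc = ones (min cT.pc P.length) := by
    rw [hI₅, IcheckL_apply]; simp [I₄, PPSTInterp.canon]
  have h6 := runs_pcTest P.length (min cT.pc P.length) o₅ zv M (update G .ok (flag o₅)) I₅ X₅
    (by simp) epc5 (Nat.min_le_right _ _)
  have epc1 : X₅ .pc1 = X .pc1 := by rw [hX₅, XcheckL_apply]; simp [X₃, X₂, X₁, Xload]
  rw [epc1, update_idem] at h6
  set o₆ := o₅ && decide (min cT.pc P.length = min (X .pc1).length P.length) with ho₆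
  -- clean up
  have h7 := runs_clear (sx (K := K) .c1)
    (sst (st (AReg.file [] [] zv [] [] [] [] []) M (update G .ok (flag o₆))) (update I₅ .pc [])
      (update X₅ .pc1 []))
  have ec1 : X₅ .c1 = X .c1 := by rw [hX₅, XcheckL_apply]; simp [X₃, X₂, X₁, Xload]
  simp only [sst_sx, update_sst_sx] at h7
  rw [update_of_ne (by simp : (SX.c1 : SX K) ≠ SX.pc1), ec1] at h7
  -- the final banks
  have eI : update I₅ .pc [] = fun _ => [] := by
    funext i
    by_cases hi : i = .pc
    · subst hi; simp
    · rw [update_of_ne hi, hI₅, IcheckL_apply]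
      cases i <;> simp [List.mem_finRange, I₄, PPSTInterp.canon] at hi ⊢
  have eX : update (update X₅ .pc1 []) .c1 [] = fun _ => [] := by
    funext z
    by_cases hz : z = .c1
    · subst hz; simp
    · rw [update_of_ne hz]
      by_cases hz' : z = .pc1
      · subst hz'; simp
      · rw [update_of_ne hz', hX₅, XcheckL_apply]
        cases z <;> simp [List.mem_finRange, X₃, X₂, X₁, Xload, hw1, hw2] at hz hz' ⊢
  have eG : flag o₆ = flag (o && simVal P X) := by
    simp only [ho₆, ho₅, simVal, Bool.and_assoc, ← hc₀, ← hhh, ← hb, ← hcT, ← hsMin, ← hsMax]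
  -- costs
  have cload : (List.map (fun k => (X (SX.fr k)).length) (List.finRange K)).sum ≤ xsum X := by
    rw [sum_finRange]; exact sum_le_xsum X _ (fun a b h => SX.fr.inj h)
  have cpcu := le_xsum X .pcu
  have cpc1 := le_xsum X .pc1
  have cub : b ≤ xsum X := le_xsum X .ub
  have cc1 := le_xsum X .c1
  have ccheck : checkCost I₄ X₃ sMin sMax (List.finRange K) ≤
      1764 * xsum X + 884 * K * b + 3080 * xsum X + 440 * K * (X .c1).length + 9 * xsum X + 940 * K := by
    -- per-stack bound
    have hper : ∀ k, 440 * ((I₄ (.r k)).length + sMin k + sMax k + flen X₃ k + (X₃ .c1).length) +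
        9 * (X₃ (.efr k)).length + 2 * ((I₄ (.dn k)).length + (I₄ (.up k)).length) + 940 ≤
        1764 * hh k + 884 * b + 440 * F7 X k + 440 * (X .c1).length + 9 * (X (.efr k)).length + 940 := by
      intro k
      have a1 : (I₄ (.r k)).length = (cT.regs k).length := by
        simp [I₄, PPSTInterp.canon]
      have a2 : (I₄ (.dn k)).length = (cT.regs k).length - sMin k := by
        simp [I₄, PPSTInterp.canon]
      have a3 : (I₄ (.up k)).length = sMax k - (cT.regs k).length := by
        simp [I₄, PPSTInterp.canon]
      have a4 : (X₃ .c1).length = (X .c1).length := by simp [X₃, X₂, X₁, Xload]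
      have a5 : (X₃ (.efr k)).length = (X (.efr k)).length := by simp [X₃, X₂, X₁, Xload]
      have a6 : flen X₃ k = F7 X k + (encodeNat (hh k)).length := by
        simp [flen, F7, X₃, X₂, X₁, Xload, List.mem_finRange, hh, h0]
      have b1 : (cT.regs k).length ≤ hh k + b := length_regs_iterate_le P c₀ k b
      have b2 : sMin k ≤ hh k := statMin_le P b c₀ hh k (fun _ => le_rfl)
      have b3 : sMax k ≤ hh k + b := statMax_le P b c₀ k
      have b4 := length_encodeNat_le (hh k)
      rw [a1, a2, a3, a4, a5, a6]
      omega
    have hsum := List.sum_le_sum (l := List.finRange K) (fun k _ => hper k)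
    unfold checkCost
    refine hsum.trans ?_
    rw [sum_finRange]
    have s1 : ∑ k : Fin K, hh k ≤ xsum X := sum_le_xsum X _ (fun a b h => SX.fr.inj h)
    have s2 : ∑ k : Fin K, F7 X k ≤ 7 * xsum X := by
      have t1 := sum_le_xsum X _ (fun a b h => SX.htu.inj h)
      have t2 := sum_le_xsum X _ (fun a b h => SX.ht1.inj h)
      have t3 := sum_le_xsum X _ (fun a b h => SX.cutu.inj h)
      have t4 := sum_le_xsum X _ (fun a b h => SX.mnu.inj h)
      have t5 := sum_le_xsum X _ (fun a b h => SX.mxu.inj h)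
      have t6 := sum_le_xsum X _ (fun a b h => SX.lou.inj h)
      have t7 := sum_le_xsum X _ (fun a b h => SX.hibu.inj h)
      unfold F7
      simp only [Finset.sum_add_distrib]
      omega
    have s3 : ∑ k : Fin K, (X (.efr k)).length ≤ xsum X := sum_le_xsum X _ (fun a b h => SX.efr.inj h)
    simp only [Finset.sum_add_distrib, ← Finset.mul_sum, Finset.sum_const, Finset.card_univ,
      Fintype.card_fin, smul_eq_mul]
    nlinarith [s1, s2, s3]
  refine (h1.seq (h2.seq (h3.seq (h4.seq (h5.seq (h6.seq h7)))))).of_eq (by rw [eI, eX, eG]) ?_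
  simp only [List.length_finRange]
  nlinarith [cload, cpcu, cpc1, cub, cc1, ccheck, Nat.zero_le (xsum X), Nat.zero_le K,
    Nat.zero_le P.length, Nat.zero_le b]

/-! ### The meaning of the outcome -/

/-- **The conditions checked**, on the values of the inputs: the seven clauses of
`TM2Blocks.CondSim` — (a) start heights, (r) room, (b) end control (capped counters), (c) end
heights, (d) end contents, (e) extreme heights, (f) coverage — for the flat run of `P` from the
claimed counter and fragments, for `b = |ub|` steps. [cite: PaulEtAl1983, §3] -/
def SimProp (P : AProg Bool (Fin K)) (X : Regs (SX K)) : Prop :=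
  let U : ℕ → ACfg Bool (Fin K) := fun t => P.step^[t] (startA X)
  let b := (X .ub).length
  (∀ k, (X (.fr k)).length + bitsToNat (X (.cutu k)) = bitsToNat (X (.htu k))) ∧
  (∀ k, 0 < bitsToNat (X (.lou k)) → bitsToNat (X .c1) ≤ (X (.fr k)).length) ∧
  (min (U b).pc P.length = min (X .pc1).length P.length) ∧
  (∀ k, bitsToNat (X (.ht1 k)) = ((U b).regs k).length + bitsToNat (X (.cutu k))) ∧
  (∀ k, X (.efr k) = (U b).regs k) ∧
  (∀ k, (∀ t, t ≤ b → bitsToNat (X (.mnu k)) ≤ bitsToNat (X (.cutu k)) + ((U t).regs k).length) ∧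
    (∃ t, t ≤ b ∧ bitsToNat (X (.mnu k)) = bitsToNat (X (.cutu k)) + ((U t).regs k).length) ∧
    (∀ t, t ≤ b → bitsToNat (X (.cutu k)) + ((U t).regs k).length ≤ bitsToNat (X (.mxu k))) ∧
    (∃ t, t ≤ b ∧ bitsToNat (X (.mxu k)) = bitsToNat (X (.cutu k)) + ((U t).regs k).length)) ∧
  (∀ k, bitsToNat (X (.htu k)) ≤ bitsToNat (X (.hibu k)))

/-- `allK` is the conjunction of the `kVal`. [folklore] -/
theorem allK_eq_true_iff (X : Regs (SX K)) (f0 : Fin K → ℕ) (R : Fin K → List Bool)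
    (smin smax : Fin K → ℕ) : ∀ ks, allK X f0 R smin smax ks = true ↔
      ∀ k ∈ ks, kVal X k (f0 k) (R k) (smin k) (smax k) = true
  | [] => by simp [allK]
  | k :: ks => by simp [allK, allK_eq_true_iff X f0 R smin smax ks]

/-- **The running minimum characterizes the minimum clause of (e).** [folklore] -/
theorem statMin_iff (P : AProg Bool (Fin K)) (f : ℕ) (c : ACfg Bool (Fin K)) (k : Fin K)
    (cut mn : ℕ) (hh : Fin K → ℕ) (hhh : hh = fun k => (c.regs k).length) :
    PPSTInterp.statMin P f c hh k + cut = mn ↔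
      (∀ t, t ≤ f → mn ≤ cut + ((P.step^[t] c).regs k).length) ∧
        ∃ t, t ≤ f ∧ mn = cut + ((P.step^[t] c).regs k).length := by
  subst hhh
  obtain ⟨hall, h0, hatt⟩ := PPSTInterp.statMin_spec P f c (fun k => (c.regs k).length) k
    (fun _ => le_rfl)
  have hatt' : ∃ t, t ≤ f ∧ PPSTInterp.statMin P f c (fun k => (c.regs k).length) k =
      ((P.step^[t] c).regs k).length := by
    rcases hatt with h | h
    · exact ⟨0, Nat.zero_le _, by simpa using h⟩
    · exact h
  constructor
  · rintro rfl
    refine ⟨fun t ht => by have := hall t ht; omega, ?_⟩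
    obtain ⟨t, ht, e⟩ := hatt'
    exact ⟨t, ht, by omega⟩
  · rintro ⟨h1, t, ht, e⟩
    obtain ⟨t', ht', e'⟩ := hatt'
    have := hall t ht
    have := h1 t' ht'
    omega

/-- **The running maximum characterizes the maximum clause of (e).** [folklore] -/
theorem statMax_iff (P : AProg Bool (Fin K)) (f : ℕ) (c : ACfg Bool (Fin K)) (k : Fin K)
    (cut mx : ℕ) (hh : Fin K → ℕ) (hhh : hh = fun k => (c.regs k).length) :
    PPSTInterp.statMax P f c hh k + cut = mx ↔
      (∀ t, t ≤ f → cut + ((P.step^[t] c).regs k).length ≤ mx) ∧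
        ∃ t, t ≤ f ∧ mx = cut + ((P.step^[t] c).regs k).length := by
  subst hhh
  obtain ⟨hall, h0, hatt⟩ := PPSTInterp.statMax_spec P f c (fun k => (c.regs k).length) k
    (fun _ => le_rfl)
  have hatt' : ∃ t, t ≤ f ∧ PPSTInterp.statMax P f c (fun k => (c.regs k).length) k =
      ((P.step^[t] c).regs k).length := by
    rcases hatt with h | h
    · exact ⟨0, Nat.zero_le _, by simpa using h⟩
    · exact h
  constructor
  · rintro rfl
    refine ⟨fun t ht => by have := hall t ht; omega, ?_⟩
    obtain ⟨t, ht, e⟩ := hatt'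
    exact ⟨t, ht, by omega⟩
  · rintro ⟨h1, t, ht, e⟩
    obtain ⟨t', ht', e'⟩ := hatt'
    have := hall t ht
    have := h1 t' ht'
    omega

/-- **`simVal` decides `SimProp`.** [cite: PaulEtAl1983, §3] -/
theorem simVal_iff (P : AProg Bool (Fin K)) (X : Regs (SX K)) : simVal P X = true ↔ SimProp P X := by
  unfold simVal SimProp
  simp only [Bool.and_eq_true, decide_eq_true_eq, allK_eq_true_iff, List.mem_finRange,
    forall_const]
  have hk : ∀ k, kVal X k (h0 X k) ((P.step^[(X .ub).length] (startA X)).regs k)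
      (PPSTInterp.statMin P (X .ub).length (startA X) (h0 X) k)
      (PPSTInterp.statMax P (X .ub).length (startA X) (h0 X) k) = true ↔
      ((P.step^[(X .ub).length] (startA X)).regs k = X (.efr k) ∧
        (X (.fr k)).length + bitsToNat (X (.cutu k)) = bitsToNat (X (.htu k)) ∧
        (0 < bitsToNat (X (.lou k)) → bitsToNat (X .c1) ≤ (X (.fr k)).length) ∧
        ((P.step^[(X .ub).length] (startA X)).regs k).length + bitsToNat (X (.cutu k)) =
          bitsToNat (X (.ht1 k)) ∧
        ((∀ t, t ≤ (X .ub).length → bitsToNat (X (.mnu k)) ≤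
            bitsToNat (X (.cutu k)) + ((P.step^[t] (startA X)).regs k).length) ∧
          ∃ t, t ≤ (X .ub).length ∧ bitsToNat (X (.mnu k)) =
            bitsToNat (X (.cutu k)) + ((P.step^[t] (startA X)).regs k).length) ∧
        ((∀ t, t ≤ (X .ub).length →
            bitsToNat (X (.cutu k)) + ((P.step^[t] (startA X)).regs k).length ≤ bitsToNat (X (.mxu k))) ∧
          ∃ t, t ≤ (X .ub).length ∧ bitsToNat (X (.mxu k)) =
            bitsToNat (X (.cutu k)) + ((P.step^[t] (startA X)).regs k).length) ∧
        bitsToNat (X (.htu k)) ≤ bitsToNat (X (.hibu k))) := by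
    intro k
    have e1 := statMin_iff P (X .ub).length (startA X) k (bitsToNat (X (.cutu k)))
      (bitsToNat (X (.mnu k))) (h0 X) rfl
    have e2 := statMax_iff P (X .ub).length (startA X) k (bitsToNat (X (.cutu k)))
      (bitsToNat (X (.mxu k))) (h0 X) rfl
    have er : (decide (bitsToNat (X (.lou k)) = 0) || decide (bitsToNat (X .c1) ≤ h0 X k)) =
        true ↔ (0 < bitsToNat (X (.lou k)) → bitsToNat (X .c1) ≤ (X (.fr k)).length) := by
      simp only [h0]
      simp only [Bool.or_eq_true, decide_eq_true_eq]
      constructor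
      · rintro (h | h) hp
        · omega
        · exact h
      · intro h
        by_cases hz : bitsToNat (X (.lou k)) = 0
        · exact Or.inl hz
        · exact Or.inr (h (Nat.pos_of_ne_zero hz))
    simp only [kVal, Bool.and_eq_true, decide_eq_true_eq]
    rw [er, e1, e2]
    simp only [h0, and_assoc]
  simp only [hk]
  constructor
  · rintro ⟨h, hpc⟩
    exact ⟨fun k => (h k).2.1, fun k => (h k).2.2.1, hpc, fun k => (h k).2.2.2.1.symm,
      fun k => (h k).1.symm, fun k => ⟨(h k).2.2.2.2.1.1, (h k).2.2.2.2.1.2, (h k).2.2.2.2.2.1.1,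
        (h k).2.2.2.2.2.1.2⟩, fun k => (h k).2.2.2.2.2.2⟩
  · rintro ⟨ha, hr, hb, hc, hd, he, hf⟩
    exact ⟨fun k => ⟨(hd k).symm, ha k, hr k, (hc k).symm, ⟨(he k).1, (he k).2.1⟩,
      ⟨(he k).2.2.1, (he k).2.2.2⟩, hf k⟩, hb⟩

end PPSTSim

end Literature.Computability.Complexity
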